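import Literature.MathematicalPhysics.QuantumFieldTheory.BalabanImbrieJaffe1984to88.BIJ88Ineq238FlatTorus
import Literature.MathematicalPhysics.QuantumFieldTheory.BalabanImbrieJaffe1984to88.BIJ88LocWeights227Torus
import Literature.MathematicalPhysics.QuantumFieldTheory.BalabanImbrieJaffe1984to88.BIJ88Eq240FlatTorus
import Literature.MathematicalPhysics.QuantumFieldTheory.BalabanImbrieJaffe1984to88.BIJ88Decay241FlatTorus

/-!
# `BalabanImbrieJaffe1984to88.BIJ88Ineq238FlatCwtTorus` — T. Bałaban, J. Imbrie, A. Jaffe, *Effective action and cluster properties of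
the abelian Higgs model*, Commun. Math. Phys. **114** (1988) 257–315 [BalabanImbrieJaffe1988], Sect. 2 pp. 263–264 [PDF 7–8]:
**(2.38) AT EVERY PURE-GAUGE BACKGROUND `u = 1^h` FOR THE PRINTED LOCALIZATION DATA** — the cubes `{□_α}`, the weights `λ_α` of (2.27)
and the cut-off `ζ″` of (2.29) CONSTRUCTED on the torus of record (gen 26's `BIJ88LocWeights227Torus`), so that p31's (2.38) at flat
backgrounds (`BIJ88Ineq238FlatTorus.ineq238_flat` / v1.1 `ineq238_flat_mult`, which take that data, the multiplicity and the admissibility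
class as HYPOTHESES) becomes a theorem about every field `φ` supported on `k`-lattice sites whose blocks lie deep inside the box `Ω₀`; plus the
(2.37) member for the constructed cut-off.

statement-level skeleton of published theorems with citation tags; proofs where landed; nothing here is a claim about the Yang–Mills mass gap

PDF held: `paper:balaban1988-cmp114-bij-abelian-higgs-effective-action` (journal page = PDF page + 256); pp. 263–264 [PDF 7–8] re-read this session.

CITATION HEADER (lean-in-tree rule).  Part of the lit-balaban TYPED SKELETON (HOME `run/shared/lean/pub/lit-balaban/`), PHASE-2 proof seat
p29 gen 27 (unit `lit-balaban-p29-g27`; TAKING line HOME/STATUS.md 2026-08-22T18:54:06Z; free-target protocol G.5-34(d) — the natural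
successor of this seat's gen-26 file and of p31 g18's `BIJ88Ineq238FlatTorus` (p337802, v1.1 p339053 `ineq238_flat_mult`): item 2 (ii) of the owner's
`HOME/lit-balaban-r18/C2S14-CLOSURE.md` §5, *"feeding the members into p02's (2.35)/(2.36)/(2.38)… hence-steps by name"*).  Rows
**C2.Eq2.38** and **C2.Eq2.37** (owner r18; heads «proved (p02)» = p02's abstract hence-steps `BIJ88Ineq238Proof`, gen 15's
`deltaLocT_apply_eq_zero`); this file adds the LOCATED MEMBERS FOR THE TORUS DATA.  Kind: theorems only (no definition, no `Prop`-valued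
fact introduced; nothing of p31's / p02's / p13's files restated — used BY NAME).

THE PRINTED TEXT (verbatim).  p. 264 [PDF 8]: *"Again we assume u is smooth in the relevant regions; Δ_{k,loc}(u; x₁,x₂) depends on u only
in an O(r(e_k))-neighborhood of x₁, x₂. Finally, in view of (2.35), the lower bound (I.7.3.2) applies to Δ_{k,loc}(u) as well. Let φ be
supported in a region having an r(e_k) neighborhood where u is smooth. Then
⟨φ, Δ_{k,loc}(u)φ⟩ ≧ c Σ_{b∈T₁^{(k)*}} |u(⟨b₋,b₊⟩)φ(b₊) − φ(b₋)|² − ce_k²p(e_k)² Σ_{x∈T₁^{(k)}} |φ(x)|². (2.38)"*; p. 263 [PDF 7]: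
*"Δ_{k,loc}(u;x₁,x₂) = 0 if |x₁ − x₂| ≧ (1/2L) r(e_{k−1}). (2.37)"*, *"|Δ_{k,loc}(u;x₁,x₂) − Δ_k(Ω,u;x₁,x₂)| ≦ e^{−cr(e_k)}e^{−c|x₁−x₂|} for
dist({x₁,x₂},Ω^c) > O(r(e_k)), (2.35)"*.  [I] = [BalabanImbrieJaffe1985] (CMP **97**) p. 326 (7.3.2), as quoted in p31's files.

THE OBJECTS (gen 15–17, gen 26; unchanged).  `Δ_{k,loc}(1^h) = deltaLocT A ε^{−1} (1^h) k cubeFam lamFam ζ″` on `ℓ²(T^{(k)})` with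
`A = α_kL^{kd}`, `a_k = B1.aSeq a L k`, the no-wrap box `Ω₀ = cubeT hPd (L^k) c (L^k·M₀)` shorter than the torus and leaving a torus gap `≥ R`,
the TORUS DATA of gen 26: cubes `cubeFam` (`cubeOf`: chart boxes `sα ± W` rounded outward to `k`-blocks, clipped to `Ω₀`), weights
`lamFam` (`lamT = cwt s α ∘ boxCoord`, p13's [6]-partition of unity), cut-off `ζ″ = cutoff R₁ R₀ (B5Ineq137Torus.T P 0)` (p13).
`u_k(b) = h(b₋)h(b₊)^{−1}` read at the corner points = the transport of `1^h` along `b`.  Normalization: `deltaLocT = (A/a_k)×` the printed kernel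
(p31 gen 17), so the printed constants appear multiplied by `A/a_k`, exactly as in `ineq238_flat`.

THE MECHANISM (p31's gen-18 assembly, fed with gen 26's data facts).  p31's `ineq238_flat` is p02's hence-step
`ineq238_loc_of_kernelClose` on (a) (I.7.3.2) for the REGION form `Δ_k(Ω₀,1^h)` (`BIJ85Ineq732FlatRegion.ineq732_pureGauge_region_of`, every
bond meeting `supp φ` inside `Ω₀^{(k)*}`) and (b) the kernel closeness (2.35) on `supp φ × supp φ` (`close235_flat_level`), with the data
hypotheses (i)–(iii) and ONE global multiplicity set `S` displayed; its v1.1 **`ineq238_flat_mult`** (p339053, written by p31 as *"the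
interface the torus instance of the (2.27)/(2.29) data needs"*) replaces `S` by a PER-ROW multiplicity `m`.  This file feeds `ineq238_flat_mult`
BY NAME: on every block `B^k(y₁)`, `y₁ ∈ supp φ` (deep by hypothesis), the row hypotheses are gen 26's `rowHyp_i` / `rowHyp_ii` / `rowHyp_iii`
(through `mem_and_depth_of_mem_blockK`) and the label set is gen 26's `activeLabels` of the block with `card_activeLabels_le`, so
`m = (⌊(L^k − 1 + R₀)/s⌋ + 3)^{d+1}` UNIFORMLY in `supp φ`.  §1 supplies the support geometry: a `k`-site whose block has chart margin `≥ L^k`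
in `Ω₀` has all its `T^{(k)}`-neighbours' blocks inside `Ω₀` (no wrap-around: the box is shorter than the torus), so the printed *"φ supported
in a region having an r(e_k) neighborhood…"* = ONE chart-margin hypothesis when `L^k ≤ R₀`.

WHAT IS PROVED (theorems only; 0 `sorry`; standard axioms).
* §1 `val_shift_of_deep` / `val_of_shift_eq_of_deep` (labels of the `T^{(k)}`-neighbours of a deep site: no wrap-around), `deep_shift` /
  `deep_of_shift_eq` (a neighbour of a site of chart margin `M ≥ L^k` has chart margin `M − L^k`), `mem_innerK_of_deep` (deep ⇒ block inside
  `Ω₀`), **`mem_starB_innerK_of_deep`** (every unit bond of `T^{(k)}` meeting the support of a field supported at chart margin `≥ L^k` lies in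
  `Ω₀^{(k)*}` — p31's bond hypothesis DISCHARGED).
* §2 **`vanishes237_cwt`** — (2.37) for the constructed cut-off, ANY background `u`: `Δ_{k,loc}(u; y₁, y₂) = 0` once
  `L^k|y₁ − y₂|_{T^{(k)}} ≥ R₀ + (L^k − 1)` (p31's `vanishes237_metric` with `hζ0 :=` p13's `isCutoff_cutoff`).
* §3 **`ineq238_flat_cwt`** — `∃ δ₀ c₁ > 0` (from `(d, ℓ, a)`) ∀ volumes (`P.d = d+1`, `P.L = ℓ+1`) ∀ `1 ≤ k ≤ K` ∀ no-wrap boxes `Ω₀` fitting,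
  shorter than the torus and leaving a torus gap `≥ R` ∀ cube spacings `s ≥ 1`, half-widths `W ≥ 2s/3 + R₀/2 + R`, radii `0 ≤ R`, `0 ≤ R₁ < R₀`
  ∀ pure gauges `h` ∀ `φ : T^{(k)} → ℂ` supported on sites whose `k`-blocks lie in `Ω₀` with chart margin `R₀` and whose unit bonds lie in
  `Ω₀^{(k)*}`:  `(A/a_k)·( min(a_k/(8d), ½)·Σ_{b}|u_k(b)φ(b₊) − φ(b₋)|² − a_k²c₁(m·e^{−2δ₀R/L^k} + e^{−(δ₀/2)R₁/L^k})·Σ_x|φ(x)|² ) ≤ Re φᴴΔ_{k,loc}(1^h)φ`,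
  `m = (⌊(L^k − 1 + R₀)/s⌋ + 3)^{d+1}`; **`ineq238_flat_cwt_of_le`** — the same with the bond hypothesis replaced by `L^k ≤ R₀` (§1);
  `ineq238_flat_cwt_three_pow` — for `s ≥ L^k + R₀` the multiplicity is `3^{d+1}`.
* §4 **`ineq238_flat_cwt_instance`** — every hypothesis met at once on the `Setup` tori with `(d, L, m, K) = (1, 3, 1, 3)` (`ℤ/162`; `k = 1`,
  `Ω₀ = [0, 12)`, `s = 1`, `W = 4`, `R = 0`, `R₁ = 0`, `R₀ = 3`, `φ = δ_{y₁}`, `y₁ = 1 ∈ ℤ/54`): the (2.38) inequality holds there for every pure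
  gauge `h` (stated for every such parameter record, so the file declares no definition).
* §5 (v1.1) **`rowHyps_of_deep`** (p31's row hypotheses (i)–(iii) + multiplicity `m` on the block of every deep `k`-site, packaged),
  `mem_starB_of_mem_of_deep` (bonds meeting a deep region lie in `Ω₀^{(k)*}` when `L^k ≤ R₀`), **`eq240_flat_cwt`** — (2.39)/(2.40) AT FLAT `u`
  FOR THE PRINTED DATA: for `Λ ⊆ T^{(k)}` a union of `L`-blocks of deep sites whose unit bonds lie in `Ω₀^{(k)*}`, `k + 1 ≤ m + K`,
  `κ = a′L′^{−2} ≥ 0` and the (2.35)-error below the flat Poincaré constant, p02's `Eq240 a′ L′ (Δ_{k,loc}(1^h)|_Λ) (Q̃|_Λ)^* (Q̃|_Λ) C` holds with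
  `C = [(Δ_{k,loc}(1^h) + κQ^*Q)|_Λ]^{−1}` (p31's `eq240_deltaLocT_flat` BY NAME, data hypotheses discharged by gen 26); **`Z49_flat_cwt`** —
  (4.9)_{j = k ≥ 1} AT FLAT `u` FOR THE PRINTED DATA: the realified precision matrix is positive definite and r18's closed form for `Z^{(k)}_Λ`
  holds (p31's `Z49_deltaLocT_flat` BY NAME; the symmetry of `λ_α`, `ζ″` is gen 26's `lamT_comm` and `T_symm`); `Z49_flat_cwt_of_le` — the same
  with the bond hypothesis replaced by `L^k ≤ R₀`.
* §6 (v1.2) **`decay241_flat_cwt`** — (2.41) AT FLAT `u` FOR THE PRINTED DATA: for every multiplicity bound `m ≥ (⌊(L^k − 1 + R₀)/s⌋ + 3)^{d+1}`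
  and `κ̂ > 0`, constants `δ₀, c₁, δ₁, c₂` from `(d, ℓ, a, m, κ̂)` such that, under the hypotheses of `eq240_flat_cwt` and the (2.35)-error at
  most half the flat Poincaré constant, `‖[(Δ_{k,loc}(1^h) + (A/a_k)κ̂Q^*Q)|_Λ]^{−1}(x₁,x₂)‖ ≤ (a_k/A)c₂e^{−δ₁|x₁−x₂|_{T^{(k)}}}` (p31's
  `decay241_deltaLocT_flat` BY NAME); `decay241_flat_cwt_three_pow` — `m = 3^{d+1}` for `s ≥ L^k + R₀`, bond hypothesis replaced by `L^k ≤ R₀`.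
HONEST SCOPE.  (i) FLAT / PURE-GAUGE BACKGROUNDS ONLY (p31's (i): the `e_k²p(e_k)²` field-strength term is absent at `u = 1^h`; nothing is
claimed for (2.32)-smooth `u`, XL).  (ii) p02's two-constant reading: the (2.35) error is the explicit second constant.  (iii) `Ω` = a no-wrap
box `Ω₀` shorter than the torus with torus gap `≥ R` (gen 26 (b)); the printed *"region having an r(e_k) neighborhood"* = the chart-margin-`R₀`
hypothesis on the blocks of `supp φ` (gen 26 (c)), the printed radii (cube side `(1/2L)r(e_{k−1})`, `R, R₁ ~ r(e_k)`, `R₀ = (1/4L)r(e_{k−1})`, in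
`k`-lattice units `×L^k`) ONE admissible assignment of the free parameters `s, W, R, R₀, R₁` (gen 26 (a)); at those radii the bracket is
`e^{−cr(e_k)}` at every level `k`.  (iv) Lipschitz profile of p13 in place of `C^∞` (gen 26 (e)).  (v) `j = 0`, window `a₋ = a₊ = a`, constants
not optimized.  (vi) (2.40)/(4.9) of §5 and (2.41) of §6 at FLAT `u` only, in gen 15's counting normalization (p31's HONEST SCOPE
(ii)–(iii) of `BIJ88Eq240FlatTorus` and of `BIJ88Decay241FlatTorus` apply verbatim), with the smallness of the (2.35)-error an explicit
HYPOTHESIS (true at the printed radii once `r(e_k)` is large; not derived here); the (2.41) constants depend on the multiplicity bound `m`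
(volume-free only in the regime `s ≥ L^k + R₀`, `m = 3^{d+1}`).
Imports: p31 `BIJ88Ineq238FlatTorus` v1.1 (→ `BIJ85Ineq732FlatRegion`, `BIJ88DeltaLocFlatClose235`, p02 `BIJ88Ineq238Proof`), gen 26
`BIJ88LocWeights227Torus` (→ p13 `BIJ88ConvexWeights227`, `BIJ88Cutoffs21`), (v1.1) p31 `BIJ88Eq240FlatTorus` (→ r18 `BIJ88Normalization49Of238`,
p02 `BIJ88Eq240Existence`), (v1.2) p31 `BIJ88Decay241FlatTorus` (→ [6] Sect. 5 engine `QGQInverse` / `B4Sect5Torus`).  Literature + Mathlib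
only.  Unit `lit-balaban-p29` (literature-prover-lit-balaban-p29-g27-0), 2026-08-22; v1.1 = APPEND-ONLY §5 + one import (p341643); v1.2 =
APPEND-ONLY §6 + one import (everything else byte-identical to v1.1 except this docstring).  NOT summit progress.
-/

open scoped BigOperators Matrix ComplexConjugate
open Finset Matrix

namespace Literature.MathematicalPhysics.QuantumFieldTheory.BalabanImbrieJaffe1984to88.BIJ88Ineq238FlatCwtTorus

open Literature.MathematicalPhysics.QuantumFieldTheory.Balaban1983to89
open BIJ88Sect3Statements (U1 toC starB mem_starB)
open BIJ85BlockAveragesTorus BIJ85BlockAveragesTorusK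
open BIJ85BlockKPoincare (sitesPerDir_eq_mul_pow)
open BIJ88NeumannNoZeroModesTorus (IsBlockUnion innerK mem_innerK)
open BIJ88NeumannPropagator227Torus
open BIJ88DeltaLoc234Torus (deltaLocT deltaRegion)
open BIJ88NeumannPropagatorFlatDecayCube (cubeT isBlockUnion_cubeT boxCoord)
open BIJ88DeltaLocFlatClose235 (vanishes237_metric)
open BIJ88Ineq238FlatTorus (ineq238_flat_mult)
open BIJ88LocWeights227Torus
open BIJ88Cutoffs21 (cutoff)
open GaugeField (gaugeAct)

noncomputable section

variable {d : ℕ} {P : Params}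

/-! ## §1 Support geometry: the `T^{(k)}`-neighbours of a site whose `k`-block lies deep inside the no-wrap box `Ω₀` -/

section Support

variable (hPd : P.d = d + 1) {c M0 : Fin (d + 1) → ℕ} {k : ℕ}

/-- kernel: the label of `y + e_μ` in direction `μ`. [folklore] -/
private theorem shift_apply_self {j : ℕ} (y : Balaban1983to89.Site P j) (μ : Fin P.d) : (y.shift μ) μ = y μ + 1 := by
  show Function.update y μ (y μ + 1) μ = _
  exact Function.update_self ..

/-- kernel: the other labels of `y + e_μ` are those of `y`. [folklore] -/
private theorem shift_apply_of_ne {j : ℕ} (y : Balaban1983to89.Site P j) {μ ν : Fin P.d} (h : ν ≠ μ) : (y.shift μ) ν = y ν := by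
  show Function.update y μ (y μ + 1) ν = _
  exact Function.update_of_ne h ..

/-- kernel: **no wrap-around upward.**  If the `k`-block of `y ∈ T^{(k)}` lies in `Ω₀ = c·L^k + Π_i[0, L^k·M₀_i)` (a box fitting in the torus,
`c_i·L^k + L^k·M₀_i ≤ |T^{(0)}|`) with chart margin `M ≥ L^k` above, then the label of `y + e_μ` in direction `μ` is `(y)_μ + 1` (no reduction
modulo `|T^{(k)}| = |T^{(0)}|/L^k`). [cite: BalabanImbrieJaffe1985, (2.4) p.302, dictionary] -/
theorem val_shift_of_deep (hk : 0 + k ≤ P.m + P.K) (hfit : ∀ i, c i * P.L ^ k + P.L ^ k * M0 i ≤ P.sitesPerDir 0) {M : ℝ}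
    (hM : (P.L : ℝ) ^ k ≤ M) {y : Balaban1983to89.Site P (0 + k)} (μ : Fin P.d)
    (hup : (P.L : ℝ) ^ k * (y μ).val + P.L ^ k + M ≤ (c (Fin.cast hPd μ) : ℝ) * P.L ^ k + (P.L : ℝ) ^ k * M0 (Fin.cast hPd μ)) :
    ((y.shift μ) μ).val = (y μ).val + 1 := by
  have hLk : (0 : ℝ) < (P.L : ℝ) ^ k := pow_pos P.cast_L_pos _
  have hN : (P.sitesPerDir 0 : ℝ) = (P.sitesPerDir (0 + k) : ℝ) * (P.L : ℝ) ^ k := by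
    rw [sitesPerDir_eq_mul_pow hk]; push_cast; ring
  have hfi : ((c (Fin.cast hPd μ) * P.L ^ k + P.L ^ k * M0 (Fin.cast hPd μ) : ℕ) : ℝ) ≤ P.sitesPerDir 0 := by exact_mod_cast hfit _
  push_cast at hfi
  have hlt : ((y μ).val : ℝ) + 2 ≤ P.sitesPerDir (0 + k) := by
    have h1 : (P.L : ℝ) ^ k * (((y μ).val : ℝ) + 2) ≤ (P.L : ℝ) ^ k * P.sitesPerDir (0 + k) := by nlinarith
    exact le_of_mul_le_mul_left h1 hLk
  have hlt' : (y μ).val + 1 < P.sitesPerDir (0 + k) := by exact_mod_cast (show ((y μ).val : ℝ) + 1 < P.sitesPerDir (0 + k) by linarith)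
  rw [shift_apply_self]
  have h1 : (1 : ZMod (P.sitesPerDir (0 + k))).val = 1 := ZMod.val_one _
  rw [ZMod.val_add_of_lt (by rw [h1]; exact hlt'), h1]

/-- kernel: **no wrap-around downward.**  If `z + e_μ = y` and the `k`-block of `y` lies in `Ω₀` with chart margin `M ≥ L^k` below, then the label of
`z` in direction `μ` is `(y)_μ − 1`. [cite: BalabanImbrieJaffe1985, (2.4) p.302, dictionary] -/
theorem val_of_shift_eq_of_deep {M : ℝ} (hM : (P.L : ℝ) ^ k ≤ M) {y z : Balaban1983to89.Site P (0 + k)} {μ : Fin P.d}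
    (hz : z.shift μ = y) (hlo : (c (Fin.cast hPd μ) : ℝ) * P.L ^ k + M ≤ (P.L : ℝ) ^ k * (y μ).val) :
    (z μ).val + 1 = (y μ).val := by
  have hLk : (0 : ℝ) < (P.L : ℝ) ^ k := pow_pos P.cast_L_pos _
  have hzμ : z μ + 1 = y μ := by
    have := congrFun hz μ
    rwa [shift_apply_self] at this
  have h1 : (1 : ZMod (P.sitesPerDir (0 + k))).val = 1 := ZMod.val_one _
  by_cases hc : (z μ).val + 1 < P.sitesPerDir (0 + k)
  · rw [← hzμ, ZMod.val_add_of_lt (by rw [h1]; exact hc), h1]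
  · -- the wrapped case `(z)_μ = |T^{(k)}| − 1`, `(y)_μ = 0` contradicts the lower margin
    exfalso
    have hle : P.sitesPerDir (0 + k) ≤ (z μ).val + (1 : ZMod (P.sitesPerDir (0 + k))).val := by rw [h1]; omega
    have hv := ZMod.val_add_of_le hle
    rw [hzμ, h1] at hv
    have hzlt := ZMod.val_lt (z μ)
    have hy0 : (y μ).val = 0 := by omega
    rw [hy0, Nat.cast_zero, mul_zero] at hlo
    have hc0 : (0 : ℝ) ≤ (c (Fin.cast hPd μ) : ℝ) * P.L ^ k := by positivity
    linarith

/-- **A neighbour of a deep site is deep (one block less).**  If the `k`-block of `y` lies in `Ω₀` with chart margin `M ≥ L^k`, then the `k`-block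
of `y + e_μ` lies in `Ω₀` with chart margin `M − L^k`. [cite: BalabanImbrieJaffe1988, (2.38) p.264, dictionary] -/
theorem deep_shift (hk : 0 + k ≤ P.m + P.K) (hfit : ∀ i, c i * P.L ^ k + P.L ^ k * M0 i ≤ P.sitesPerDir 0) {M : ℝ}
    (hM : (P.L : ℝ) ^ k ≤ M) {y : Balaban1983to89.Site P (0 + k)}
    (hdeep : ∀ ν, (c (Fin.cast hPd ν) : ℝ) * P.L ^ k + M ≤ (P.L : ℝ) ^ k * (y ν).val ∧
      (P.L : ℝ) ^ k * (y ν).val + P.L ^ k + M ≤ (c (Fin.cast hPd ν) : ℝ) * P.L ^ k + (P.L : ℝ) ^ k * M0 (Fin.cast hPd ν))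
    (μ : Fin P.d) :
    ∀ ν, (c (Fin.cast hPd ν) : ℝ) * P.L ^ k + (M - P.L ^ k) ≤ (P.L : ℝ) ^ k * ((y.shift μ) ν).val ∧
      (P.L : ℝ) ^ k * ((y.shift μ) ν).val + P.L ^ k + (M - P.L ^ k) ≤
        (c (Fin.cast hPd ν) : ℝ) * P.L ^ k + (P.L : ℝ) ^ k * M0 (Fin.cast hPd ν) := by
  have hLk : (0 : ℝ) < (P.L : ℝ) ^ k := pow_pos P.cast_L_pos _
  intro ν
  obtain ⟨h1, h2⟩ := hdeep ν
  by_cases hν : ν = μ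
  · subst hν
    rw [val_shift_of_deep hPd hk hfit hM ν h2]
    push_cast
    constructor <;> nlinarith
  · rw [shift_apply_of_ne y hν]
    constructor <;> nlinarith

/-- **The lower neighbour of a deep site is deep (one block less).**  If `z + e_μ = y` and the `k`-block of `y` lies in `Ω₀` with chart margin
`M ≥ L^k`, then the `k`-block of `z` lies in `Ω₀` with chart margin `M − L^k`. [cite: BalabanImbrieJaffe1988, (2.38) p.264, dictionary] -/
theorem deep_of_shift_eq {M : ℝ} (hM : (P.L : ℝ) ^ k ≤ M) {y z : Balaban1983to89.Site P (0 + k)} {μ : Fin P.d} (hz : z.shift μ = y)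
    (hdeep : ∀ ν, (c (Fin.cast hPd ν) : ℝ) * P.L ^ k + M ≤ (P.L : ℝ) ^ k * (y ν).val ∧
      (P.L : ℝ) ^ k * (y ν).val + P.L ^ k + M ≤ (c (Fin.cast hPd ν) : ℝ) * P.L ^ k + (P.L : ℝ) ^ k * M0 (Fin.cast hPd ν)) :
    ∀ ν, (c (Fin.cast hPd ν) : ℝ) * P.L ^ k + (M - P.L ^ k) ≤ (P.L : ℝ) ^ k * (z ν).val ∧
      (P.L : ℝ) ^ k * (z ν).val + P.L ^ k + (M - P.L ^ k) ≤ (c (Fin.cast hPd ν) : ℝ) * P.L ^ k + (P.L : ℝ) ^ k * M0 (Fin.cast hPd ν) := by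
  have hLk : (0 : ℝ) < (P.L : ℝ) ^ k := pow_pos P.cast_L_pos _
  intro ν
  obtain ⟨h1, h2⟩ := hdeep ν
  by_cases hν : ν = μ
  · subst hν
    have hv : ((z ν).val : ℝ) + 1 = (y ν).val := by exact_mod_cast val_of_shift_eq_of_deep hPd hM hz h1
    constructor <;> nlinarith
  · have hzν : z ν = y ν := by
      have := congrFun hz ν
      rwa [shift_apply_of_ne z hν] at this
    rw [hzν]
    constructor <;> nlinarith

/-- **Deep ⇒ inner.**  If the `k`-block of `y` lies in `Ω₀` with chart margin `M ≥ 0`, then `y ∈ Ω₀^{(k)}` (`innerK`: its block is inside `Ω₀`;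
gen 26's `mem_and_depth_of_mem_blockK`). [cite: BalabanImbrieJaffe1988, (2.27) p.263] -/
theorem mem_innerK_of_deep (hk : 0 + k ≤ P.m + P.K) (hfit : ∀ i, c i * P.L ^ k + P.L ^ k * M0 i ≤ P.sitesPerDir 0) {M : ℝ} (hM : 0 ≤ M)
    {y : Balaban1983to89.Site P (0 + k)}
    (hdeep : ∀ ν, (c (Fin.cast hPd ν) : ℝ) * P.L ^ k + M ≤ (P.L : ℝ) ^ k * (y ν).val ∧
      (P.L : ℝ) ^ k * (y ν).val + P.L ^ k + M ≤ (c (Fin.cast hPd ν) : ℝ) * P.L ^ k + (P.L : ℝ) ^ k * M0 (Fin.cast hPd ν)) :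
    y ∈ innerK k (cubeT hPd (P.L ^ k) c fun i => P.L ^ k * M0 i) :=
  mem_innerK.2 fun _ hx => (mem_and_depth_of_mem_blockK hPd hk hfit hM hdeep hx).1

/-- **p31's bond hypothesis DISCHARGED: every unit bond of `T^{(k)}` meeting the support of a field supported on sites of chart margin `M ≥ L^k`
lies in `Ω₀^{(k)*}`** (both endpoints have their `k`-blocks inside `Ω₀` — print's *"φ supported in a region having an r(e_k) neighborhood where
u is smooth"*, p. 264, for the no-wrap box). [cite: BalabanImbrieJaffe1988, (2.38) p.264] -/
theorem mem_starB_innerK_of_deep (hk : 0 + k ≤ P.m + P.K) (hfit : ∀ i, c i * P.L ^ k + P.L ^ k * M0 i ≤ P.sitesPerDir 0) {M : ℝ}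
    (hM : (P.L : ℝ) ^ k ≤ M) {φ : Balaban1983to89.Site P (0 + k) → ℂ}
    (hsupp : ∀ y, φ y ≠ 0 → ∀ ν, (c (Fin.cast hPd ν) : ℝ) * P.L ^ k + M ≤ (P.L : ℝ) ^ k * (y ν).val ∧
      (P.L : ℝ) ^ k * (y ν).val + P.L ^ k + M ≤ (c (Fin.cast hPd ν) : ℝ) * P.L ^ k + (P.L : ℝ) ^ k * M0 (Fin.cast hPd ν)) :
    ∀ b : PBond P (0 + k), (φ b.src ≠ 0 ∨ φ b.tgt ≠ 0) → b ∈ starB (innerK k (cubeT hPd (P.L ^ k) c fun i => P.L ^ k * M0 i)) := by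
  have hLk : (0 : ℝ) < (P.L : ℝ) ^ k := pow_pos P.cast_L_pos _
  have hM0 : 0 ≤ M := hLk.le.trans hM
  have hM1 : 0 ≤ M - (P.L : ℝ) ^ k := sub_nonneg.2 hM
  intro b hb
  rw [mem_starB]
  rcases hb with h | h
  · exact ⟨mem_innerK_of_deep hPd hk hfit hM0 (hsupp _ h),
      mem_innerK_of_deep hPd hk hfit hM1 (deep_shift hPd hk hfit hM (hsupp _ h) b.dir)⟩
  · exact ⟨mem_innerK_of_deep hPd hk hfit hM1 (deep_of_shift_eq hPd hM rfl (hsupp _ h)),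
      mem_innerK_of_deep hPd hk hfit hM0 (hsupp _ h)⟩

end Support

/-! ## §2 (2.37) for the constructed cut-off, any background -/

section Vanishes

variable (hPd : P.d = d + 1) (c M0 : Fin (d + 1) → ℕ) (s W : ℕ)

/-- **(2.37) FOR THE PRINTED DATA, ANY BACKGROUND `u`** (*"Δ_{k,loc}(u;x₁,x₂) = 0 if |x₁ − x₂| ≧ (1/2L) r(e_{k−1}). (2.37)"*, p. 263): with the
cut-off `ζ″ = cutoff R₁ R₀ |·|_T` of (2.29) (`0 ≤ R₁ < R₀`, vanishing beyond sup-torus distance `R₀`), `Δ_{k,loc}(u; y₁, y₂) = 0` as soon as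
`L^k|y₁ − y₂|_{T^{(k)}} ≥ R₀ + (L^k − 1)` — p31's `vanishes237_metric` BY NAME, its hypothesis `hζ0` being p13's `isCutoff_cutoff`.
[cite: BalabanImbrieJaffe1988, (2.37) p.263] -/
theorem vanishes237_cwt {k : ℕ} (hk : 0 + k ≤ P.m + P.K) (a' c' : ℝ) (U : GaugeField P 0 U1) {R₀ R₁ : ℝ} (hR₁ : 0 ≤ R₁) (hR10 : R₁ < R₀)
    {y₁ y₂ : Balaban1983to89.Site P (0 + k)} (hfar : R₀ + (((P.L : ℝ) ^ k) - 1) ≤ ((P.L : ℝ) ^ k) * B5Ineq137Torus.T P (0 + k) y₁ y₂) :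
    deltaLocT a' c' U k (cubeFam hPd (P.L ^ k) c M0 s W) (lamFam hPd (P.L ^ k) c M0 s) (cutoff R₁ R₀ (B5Ineq137Torus.T P 0)) y₁ y₂ = 0 :=
  vanishes237_metric hk a' c' U _ _ _ (hR₁.trans_lt hR10) (cutoff_eq_zero_of_le hR10) hfar

end Vanishes

/-! ## §3 (2.38) at flat backgrounds FOR THE PRINTED DATA -/

section Flat238

/-- **(2.38) AT EVERY PURE-GAUGE BACKGROUND `u = 1^h` FOR THE PRINTED LOCALIZATION DATA** — p31's `ineq238_flat_mult` (p02's hence-step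
`ineq238_loc_of_kernelClose` on (I.7.3.2) for the region form `Δ_k(Ω₀,1^h)` and (2.35) at flat `u`, per-row multiplicity) BY NAME, its row
hypotheses (i)–(iii) and multiplicity DISCHARGED by gen 26's `rowHyp_i/ii/iii` and `card_activeLabels_le` on every block of `supp φ`
(p. 264: *"Finally, in view of (2.35), the lower bound (I.7.3.2) applies to Δ_{k,loc}(u) as well. Let φ be supported in a region having an
r(e_k) neighborhood where u is smooth. Then ⟨φ, Δ_{k,loc}(u)φ⟩ ≧ c Σ_{b∈T₁^{(k)*}} |u(⟨b₋,b₊⟩)φ(b₊) − φ(b₋)|² − ce_k²p(e_k)² Σ_{x∈T₁^{(k)}} |φ(x)|².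
(2.38)"*).  THERE EXIST `δ₀, c₁ > 0` depending on `(d, ℓ, a)` only such that for every volume (`P.d = d+1`, `P.L = ℓ+1`), every `1 ≤ k ≤ K`,
every no-wrap box `Ω₀ = c·L^k + Π_i[0, L^k·M₀_i)` shorter than the torus and leaving a torus gap `≥ R`, every cube spacing `s ≥ 1` and
half-width `W ≥ 2s/3 + R₀/2 + R`, radii `0 ≤ R`, `0 ≤ R₁ < R₀`, every pure gauge `h` and EVERY `φ : T^{(k)} → ℂ` supported on sites `y₁` whose
`k`-blocks lie in `Ω₀` with chart margin `R₀` (print's *"dist({x₁,x₂},Ω^c) > O(r(e_k))"*) and whose unit bonds lie in `Ω₀^{(k)*}` (print's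
*"region having an r(e_k) neighborhood"*; automatic when `L^k ≤ R₀`, `ineq238_flat_cwt_of_le`):
`(A/a_k)·( min(a_k/(8d), ½)·Σ_{b∈T₁^{(k)*}} |u_k(b)φ(b₊) − φ(b₋)|² − a_k²·c₁·(m·e^{−2δ₀R/L^k} + e^{−(δ₀/2)R₁/L^k})·Σ_x|φ(x)|² ) ≤ Re ⟨φ, Δ_{k,loc}(1^h)φ⟩`
with `m = (⌊(L^k − 1 + R₀)/s⌋ + 3)^{d+1}` the multiplicity of the data (gen 26 `card_activeLabels_le`; `3^{d+1}` for `s ≥ L^k + R₀`), `u_k(b) =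
h(b₋)h(b₊)^{−1}`, `A/a_k = L^{kd}(L^kε)^{−2}` the counting normalization of `deltaLocT`, and `Δ_{k,loc}` built from the torus cubes `{□_α}`, the
weights `λ_α` of (2.27) and the cut-off `ζ″` of (2.29) — i.e. the printed (2.38) at flat `u` for the printed localization, with
`c = min(a_k/(8d), ½)`, the `e_k²p(e_k)²` term zero and the (2.35) error as the explicit second constant (at the printed radii `R, R₁ ~ r(e_k)L^k`
the bracket is `e^{−cr(e_k)}` at every level `k`).  `δ₀, c₁` are p31's constants of `ineq238_flat_mult`. [cite: BalabanImbrieJaffe1988, (2.38) p.264] -/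
theorem ineq238_flat_cwt (d ℓ : ℕ) (hℓ : 1 ≤ ℓ) {a : ℝ} (ha : 0 < a) :
    ∃ δ₀ c₁ : ℝ, 0 < δ₀ ∧ 0 < c₁ ∧ ∀ (P : Params) (hPd : P.d = d + 1), P.L = ℓ + 1 →
      ∀ k : ℕ, 1 ≤ k → k ≤ P.K → ∀ (c M0 : Fin (d + 1) → ℕ), (∀ i, 1 ≤ M0 i) →
        (∀ i, c i * P.L ^ k + P.L ^ k * M0 i ≤ P.sitesPerDir 0) → (∀ i, P.L ^ k * M0 i < P.sitesPerDir 0) →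
      ∀ (s W : ℕ), 1 ≤ s → ∀ (R R₀ R₁ : ℝ), 0 ≤ R → 0 ≤ R₁ → R₁ < R₀ → 2 * (s : ℝ) / 3 + R₀ / 2 + R ≤ W →
        (∀ i, ((P.L ^ k * M0 i : ℕ) : ℝ) + R ≤ P.sitesPerDir 0) →
      ∀ (h : GaugeTransf P 0 U1) (φ : Balaban1983to89.Site P (0 + k) → ℂ),
        (∀ y₁, φ y₁ ≠ 0 → ∀ μ, (c (Fin.cast hPd μ) : ℝ) * P.L ^ k + R₀ ≤ (P.L : ℝ) ^ k * (y₁ μ).val ∧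
          (P.L : ℝ) ^ k * (y₁ μ).val + P.L ^ k + R₀ ≤ (c (Fin.cast hPd μ) : ℝ) * P.L ^ k + (P.L : ℝ) ^ k * M0 (Fin.cast hPd μ)) →
        (∀ b : PBond P (0 + k), (φ b.src ≠ 0 ∨ φ b.tgt ≠ 0) →
          b ∈ starB (innerK k (cubeT hPd (P.L ^ k) c fun i => P.L ^ k * M0 i))) →
        (B1RG242Torus.α P a k * (P.L : ℝ) ^ (k * P.d)) / B1.aSeq a P.L k *
          (min (B1.aSeq a P.L k / (8 * P.d)) (1 / 2) *
              ∑ b : PBond P (0 + k), ‖toC (h (cornerIter k b.src)) * (toC (h (cornerIter k b.tgt)))⁻¹ * φ b.tgt - φ b.src‖ ^ 2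
            - B1.aSeq a P.L k ^ 2 * c₁ *
              ((⌊(((P.L : ℝ) ^ k) - 1 + R₀) / s⌋₊ + 3) ^ (d + 1) * Real.exp (-(δ₀ * (((P.L : ℝ) ^ k)⁻¹ * (2 * R)))) +
                Real.exp (-(δ₀ / 2 * (((P.L : ℝ) ^ k)⁻¹ * R₁)))) *
              ∑ y : Balaban1983to89.Site P (0 + k), ‖φ y‖ ^ 2)
        ≤ (star φ ⬝ᵥ (deltaLocT (B1RG242Torus.α P a k * (P.L : ℝ) ^ (k * P.d)) P.eps⁻¹ (gaugeAct h (1 : GaugeField P 0 U1)) k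
            (cubeFam hPd (P.L ^ k) c M0 s W) (lamFam hPd (P.L ^ k) c M0 s) (cutoff R₁ R₀ (B5Ineq137Torus.T P 0)) *ᵥ φ)).re := by
  obtain ⟨δ₀, c₁, hδ₀, hc₁, H⟩ := ineq238_flat_mult d ℓ hℓ ha
  refine ⟨δ₀, c₁, hδ₀, hc₁, ?_⟩
  intro P hPd hPL k hk1 hkK c M0 hM0 hfit0 hN0 s W hs R R₀ R₁ hR hR₁ hR10 hW hgap h φ hsupp hnb
  have hn : 1 ≤ P.L ^ k := Nat.one_le_pow _ _ P.L_pos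
  have hk : 0 + k ≤ P.m + P.K := by omega
  have hR₀ : 0 ≤ R₀ := hR₁.trans hR10.le
  have hζ0 := cutoff_eq_zero_of_le (P := P) hR10
  set Ω₀ : Finset (Balaban1983to89.Site P 0) := cubeT hPd (P.L ^ k) c fun i => P.L ^ k * M0 i with hΩ₀def
  -- the multiplicity of the data, as a natural number
  set mN : ℕ := (⌊(((P.L : ℝ) ^ k) - 1 + R₀) / s⌋₊ + 3) ^ (d + 1) with hmNdef
  have hmN : ((mN : ℕ) : ℝ) = (((⌊(((P.L : ℝ) ^ k) - 1 + R₀) / s⌋₊ : ℕ) : ℝ) + 3) ^ (d + 1) := by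
    rw [hmNdef]; push_cast; ring
  -- the admissibility class of THIS theorem: support on deep blocks, bonds inside `Ω₀^{(k)*}`
  set Adm : (Balaban1983to89.Site P (0 + k) → ℂ) → Prop := fun ψ =>
    (∀ y₁, ψ y₁ ≠ 0 → ∀ μ, (c (Fin.cast hPd μ) : ℝ) * P.L ^ k + R₀ ≤ (P.L : ℝ) ^ k * (y₁ μ).val ∧
      (P.L : ℝ) ^ k * (y₁ μ).val + P.L ^ k + R₀ ≤ (c (Fin.cast hPd μ) : ℝ) * P.L ^ k + (P.L : ℝ) ^ k * M0 (Fin.cast hPd μ)) ∧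
    (∀ b : PBond P (0 + k), (ψ b.src ≠ 0 ∨ ψ b.tgt ≠ 0) → b ∈ starB (innerK k Ω₀)) with hAdmdef
  have hφ : Adm φ := ⟨hsupp, hnb⟩
  -- p31's row hypotheses (i)–(iii) and the per-row multiplicity, DISCHARGED by gen 26's §3–§4 on every block of `supp ψ`
  have hAdm : ∀ ψ, Adm ψ → ∀ y₁, ψ y₁ ≠ 0 →
      (∀ x ∈ blockK k y₁, ∀ y, cutoff R₁ R₀ (B5Ineq137Torus.T P 0) x y ≠ 0 → ∑ α, lamFam hPd (P.L ^ k) c M0 s α x y = 1) ∧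
      (∀ x ∈ blockK k y₁, ∀ (α : ↥(labels (P.L ^ k) M0 s)) y,
          cutoff R₁ R₀ (B5Ineq137Torus.T P 0) x y * lamFam hPd (P.L ^ k) c M0 s α x y ≠ 0 →
            x ∈ cubeFam hPd (P.L ^ k) c M0 s W α ∧ y ∈ cubeFam hPd (P.L ^ k) c M0 s W α ∧
              ∀ w ∈ cubeT hPd (P.L ^ k) c (fun i => P.L ^ k * M0 i), w ∉ cubeFam hPd (P.L ^ k) c M0 s W α →
                R ≤ B5Ineq137Torus.T P 0 x w ∧ R ≤ B5Ineq137Torus.T P 0 y w) ∧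
      (∀ x ∈ blockK k y₁, ∀ y, B5Ineq137Torus.T P 0 x y ≤ R₁ → cutoff R₁ R₀ (B5Ineq137Torus.T P 0) x y = 1) ∧
      ∃ S : Finset ↥(labels (P.L ^ k) M0 s), S.card ≤ mN ∧ ∀ x ∈ blockK k y₁, ∀ (α : ↥(labels (P.L ^ k) M0 s)) y,
          cutoff R₁ R₀ (B5Ineq137Torus.T P 0) x y * lamFam hPd (P.L ^ k) c M0 s α x y ≠ 0 → α ∈ S := by
    intro ψ hψ y₁ hy₁
    have hdeepB := hψ.1 y₁ hy₁
    have hxdeep := fun x (hx : x ∈ blockK k y₁) => mem_and_depth_of_mem_blockK hPd hk hfit0 hR₀ hdeepB hx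
    refine ⟨fun x hx => rowHyp_i hPd hfit0 hζ0 (hxdeep x hx).1 (hxdeep x hx).2,
      fun x hx => rowHyp_ii hPd hn hs hfit0 hR hgap hW hζ0 (hxdeep x hx).1 (hxdeep x hx).2, fun x _ => rowHyp_iii hR10 x,
      (activeLabels hPd (P.L ^ k) c s R₀ y₁).subtype fun α => α ∈ labels (P.L ^ k) M0 s, ?_, fun x hx α y hne => ?_⟩
    · have h1 : ((activeLabels hPd (P.L ^ k) c s R₀ y₁).subtype fun α => α ∈ labels (P.L ^ k) M0 s).card ≤
          (activeLabels hPd (P.L ^ k) c s R₀ y₁).card := by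
        rw [Finset.card_subtype]; exact Finset.card_filter_le _ _
      have h2 := card_activeLabels_le (hPd := hPd) (c := c) hn hs hR₀ y₁
      have e : (((P.L ^ k : ℕ) : ℕ) : ℝ) = (P.L : ℝ) ^ k := by push_cast; rfl
      rw [e] at h2
      exact h1.trans h2
    · rw [Finset.mem_subtype]
      exact mem_activeLabels_of_ne_zero_of_deep hk hs hfit0 hζ0 hx (hxdeep x hx).2 hne
  have h38 := H P hPd hPL k hk1 hkK c M0 hM0 hfit0 hN0 _ (cubeFam hPd (P.L ^ k) c M0 s W) (lamFam hPd (P.L ^ k) c M0 s)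
    (cutoff R₁ R₀ (B5Ineq137Torus.T P 0)) (cubeFam_nested hM0) (sum_abs_lamT_le_one hfit0) (cutoff_mem_unitInterval R₁ R₀) h R R₁ hR hR₁
    mN Adm hAdm (fun ψ hψ => hψ.2) φ hφ
  rw [hmN] at h38
  exact h38

/-- **(2.38) AT FLAT BACKGROUNDS FOR THE PRINTED DATA, ONE SUPPORT HYPOTHESIS.**  As `ineq238_flat_cwt`, for every `φ` supported on sites whose
`k`-blocks lie in `Ω₀` with chart margin `R₀ ≥ L^k` (the outer cut-off radius at least one block — print: `R₀ = (1/4L)r(e_{k−1})·L^k ≫ L^k`); the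
bond condition *"region having an r(e_k) neighborhood"* then holds by §1 (`mem_starB_innerK_of_deep`). [cite: BalabanImbrieJaffe1988, (2.38) p.264] -/
theorem ineq238_flat_cwt_of_le (d ℓ : ℕ) (hℓ : 1 ≤ ℓ) {a : ℝ} (ha : 0 < a) :
    ∃ δ₀ c₁ : ℝ, 0 < δ₀ ∧ 0 < c₁ ∧ ∀ (P : Params) (hPd : P.d = d + 1), P.L = ℓ + 1 →
      ∀ k : ℕ, 1 ≤ k → k ≤ P.K → ∀ (c M0 : Fin (d + 1) → ℕ), (∀ i, 1 ≤ M0 i) →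
        (∀ i, c i * P.L ^ k + P.L ^ k * M0 i ≤ P.sitesPerDir 0) → (∀ i, P.L ^ k * M0 i < P.sitesPerDir 0) →
      ∀ (s W : ℕ), 1 ≤ s → ∀ (R R₀ R₁ : ℝ), 0 ≤ R → 0 ≤ R₁ → R₁ < R₀ → 2 * (s : ℝ) / 3 + R₀ / 2 + R ≤ W →
        (∀ i, ((P.L ^ k * M0 i : ℕ) : ℝ) + R ≤ P.sitesPerDir 0) → (P.L : ℝ) ^ k ≤ R₀ →
      ∀ (h : GaugeTransf P 0 U1) (φ : Balaban1983to89.Site P (0 + k) → ℂ),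
        (∀ y₁, φ y₁ ≠ 0 → ∀ μ, (c (Fin.cast hPd μ) : ℝ) * P.L ^ k + R₀ ≤ (P.L : ℝ) ^ k * (y₁ μ).val ∧
          (P.L : ℝ) ^ k * (y₁ μ).val + P.L ^ k + R₀ ≤ (c (Fin.cast hPd μ) : ℝ) * P.L ^ k + (P.L : ℝ) ^ k * M0 (Fin.cast hPd μ)) →
        (B1RG242Torus.α P a k * (P.L : ℝ) ^ (k * P.d)) / B1.aSeq a P.L k *
          (min (B1.aSeq a P.L k / (8 * P.d)) (1 / 2) *
              ∑ b : PBond P (0 + k), ‖toC (h (cornerIter k b.src)) * (toC (h (cornerIter k b.tgt)))⁻¹ * φ b.tgt - φ b.src‖ ^ 2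
            - B1.aSeq a P.L k ^ 2 * c₁ *
              ((⌊(((P.L : ℝ) ^ k) - 1 + R₀) / s⌋₊ + 3) ^ (d + 1) * Real.exp (-(δ₀ * (((P.L : ℝ) ^ k)⁻¹ * (2 * R)))) +
                Real.exp (-(δ₀ / 2 * (((P.L : ℝ) ^ k)⁻¹ * R₁)))) *
              ∑ y : Balaban1983to89.Site P (0 + k), ‖φ y‖ ^ 2)
        ≤ (star φ ⬝ᵥ (deltaLocT (B1RG242Torus.α P a k * (P.L : ℝ) ^ (k * P.d)) P.eps⁻¹ (gaugeAct h (1 : GaugeField P 0 U1)) k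
            (cubeFam hPd (P.L ^ k) c M0 s W) (lamFam hPd (P.L ^ k) c M0 s) (cutoff R₁ R₀ (B5Ineq137Torus.T P 0)) *ᵥ φ)).re := by
  obtain ⟨δ₀, c₁, hδ₀, hc₁, H⟩ := ineq238_flat_cwt d ℓ hℓ ha
  refine ⟨δ₀, c₁, hδ₀, hc₁, ?_⟩
  intro P hPd hPL k hk1 hkK c M0 hM0 hfit0 hN0 s W hs R R₀ R₁ hR hR₁ hR10 hW hgap hLR h φ hsupp
  have hk : 0 + k ≤ P.m + P.K := by omega
  exact H P hPd hPL k hk1 hkK c M0 hM0 hfit0 hN0 s W hs R R₀ R₁ hR hR₁ hR10 hW hgap h φ hsupp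
    (mem_starB_innerK_of_deep hPd hk hfit0 hLR hsupp)

/-- **(2.38) AT FLAT BACKGROUNDS FOR THE PRINTED DATA WITH THE VOLUME-FREE MULTIPLICITY `3^{d+1}`**: as `ineq238_flat_cwt_of_le` for cube spacings
`s ≥ L^k + R₀` (gen 26's `card_activeLabels_le_three_pow`: the bracket is `3^{d+1}e^{−2δ₀R/L^k} + e^{−(δ₀/2)R₁/L^k}` — print's *"at most 2^d
terms"* summed over the rows of one block and the cut-off range). [cite: BalabanImbrieJaffe1988, (2.38) p.264] -/
theorem ineq238_flat_cwt_three_pow (d ℓ : ℕ) (hℓ : 1 ≤ ℓ) {a : ℝ} (ha : 0 < a) :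
    ∃ δ₀ c₁ : ℝ, 0 < δ₀ ∧ 0 < c₁ ∧ ∀ (P : Params) (hPd : P.d = d + 1), P.L = ℓ + 1 →
      ∀ k : ℕ, 1 ≤ k → k ≤ P.K → ∀ (c M0 : Fin (d + 1) → ℕ), (∀ i, 1 ≤ M0 i) →
        (∀ i, c i * P.L ^ k + P.L ^ k * M0 i ≤ P.sitesPerDir 0) → (∀ i, P.L ^ k * M0 i < P.sitesPerDir 0) →
      ∀ (s W : ℕ), 1 ≤ s → ∀ (R R₀ R₁ : ℝ), 0 ≤ R → 0 ≤ R₁ → R₁ < R₀ → 2 * (s : ℝ) / 3 + R₀ / 2 + R ≤ W →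
        (∀ i, ((P.L ^ k * M0 i : ℕ) : ℝ) + R ≤ P.sitesPerDir 0) → (P.L : ℝ) ^ k ≤ R₀ → (P.L : ℝ) ^ k + R₀ ≤ s →
      ∀ (h : GaugeTransf P 0 U1) (φ : Balaban1983to89.Site P (0 + k) → ℂ),
        (∀ y₁, φ y₁ ≠ 0 → ∀ μ, (c (Fin.cast hPd μ) : ℝ) * P.L ^ k + R₀ ≤ (P.L : ℝ) ^ k * (y₁ μ).val ∧
          (P.L : ℝ) ^ k * (y₁ μ).val + P.L ^ k + R₀ ≤ (c (Fin.cast hPd μ) : ℝ) * P.L ^ k + (P.L : ℝ) ^ k * M0 (Fin.cast hPd μ)) →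
        (B1RG242Torus.α P a k * (P.L : ℝ) ^ (k * P.d)) / B1.aSeq a P.L k *
          (min (B1.aSeq a P.L k / (8 * P.d)) (1 / 2) *
              ∑ b : PBond P (0 + k), ‖toC (h (cornerIter k b.src)) * (toC (h (cornerIter k b.tgt)))⁻¹ * φ b.tgt - φ b.src‖ ^ 2
            - B1.aSeq a P.L k ^ 2 * c₁ *
              ((3 : ℝ) ^ (d + 1) * Real.exp (-(δ₀ * (((P.L : ℝ) ^ k)⁻¹ * (2 * R)))) + Real.exp (-(δ₀ / 2 * (((P.L : ℝ) ^ k)⁻¹ * R₁)))) *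
              ∑ y : Balaban1983to89.Site P (0 + k), ‖φ y‖ ^ 2)
        ≤ (star φ ⬝ᵥ (deltaLocT (B1RG242Torus.α P a k * (P.L : ℝ) ^ (k * P.d)) P.eps⁻¹ (gaugeAct h (1 : GaugeField P 0 U1)) k
            (cubeFam hPd (P.L ^ k) c M0 s W) (lamFam hPd (P.L ^ k) c M0 s) (cutoff R₁ R₀ (B5Ineq137Torus.T P 0)) *ᵥ φ)).re := by
  obtain ⟨δ₀, c₁, hδ₀, hc₁, H⟩ := ineq238_flat_cwt_of_le d ℓ hℓ ha
  refine ⟨δ₀, c₁, hδ₀, hc₁, ?_⟩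
  intro P hPd hPL k hk1 hkK c M0 hM0 hfit0 hN0 s W hs R R₀ R₁ hR hR₁ hR10 hW hgap hLR hbig h φ hsupp
  have h38 := H P hPd hPL k hk1 hkK c M0 hM0 hfit0 hN0 s W hs R R₀ R₁ hR hR₁ hR10 hW hgap hLR h φ hsupp
  refine le_trans ?_ h38
  have hak : 0 < B1.aSeq a P.L k := B1.aSeq_pos ha (B1RG242Torus.one_lt_cast_L P) hk1
  have hα : 0 < B1RG242Torus.α P a k := mul_pos hak (inv_pos.mpr (pow_pos (P.spacing_pos k) 2))
  have hA : 0 < B1RG242Torus.α P a k * (P.L : ℝ) ^ (k * P.d) := mul_pos hα (pow_pos P.cast_L_pos _)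
  have hs0 : (0 : ℝ) < s := by exact_mod_cast hs
  have hR₀ : 0 ≤ R₀ := hR₁.trans hR10.le
  have hLk1 : (1 : ℝ) ≤ (P.L : ℝ) ^ k := one_le_pow₀ (by exact_mod_cast P.L_pos)
  -- the multiplicity: `⌊(L^k − 1 + R₀)/s⌋ = 0` for `s ≥ L^k + R₀`
  have hfloor : ⌊(((P.L : ℝ) ^ k) - 1 + R₀) / s⌋₊ = 0 := by
    rw [Nat.floor_eq_zero, div_lt_one hs0]; linarith
  have hm : ((⌊(((P.L : ℝ) ^ k) - 1 + R₀) / s⌋₊ : ℝ) + 3) ^ (d + 1) = (3 : ℝ) ^ (d + 1) := by rw [hfloor]; norm_num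
  rw [hm]

end Flat238

/-! ## §4 Non-vacuity: every hypothesis of `ineq238_flat_cwt_of_le` met at once on a genuine `Setup.Params` torus -/

section Instance

/-- **THE HYPOTHESES OF `ineq238_flat_cwt_of_le` ARE JOINTLY SATISFIABLE** (so (2.38) for the torus data is not a statement about the empty
set): on every `Setup` torus with `d = 1`, `L = 3`, `m = 1`, `K = 3` (the torus `ℤ/162`; e.g. gen 26's instance record), at `k = 1`, box
`Ω₀ = [0, 12)` (`c = 0`, `M₀ = 4`), cube spacing `s = 1`, half-width `W = 4`, radii `R = 0`, `R₁ = 0`, `R₀ = 3 = L^k`, and the field `φ = δ_{y₁}`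
at the `1`-block site `y₁ = 1 ∈ ℤ/54` (block `[3, 6)`, chart margin `3` inside `[0, 12)`), every displayed hypothesis holds; consequently the
(2.38) inequality of `ineq238_flat_cwt_of_le` holds there for every pure gauge `h`, with the multiplicity `(⌊(3 − 1 + 3)/1⌋ + 3)^1 = 8` and
constants `δ₀, c₁` depending on nothing. [cite: BalabanImbrieJaffe1988, (2.38) p.264] -/
theorem ineq238_flat_cwt_instance :
    ∃ δ₀ c₁ : ℝ, 0 < δ₀ ∧ 0 < c₁ ∧ ∀ (P : Params) (hPd : P.d = 0 + 1), P.L = 3 → P.m = 1 → P.K = 3 → ∀ (h : GaugeTransf P 0 U1),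
      (B1RG242Torus.α P 1 1 * (P.L : ℝ) ^ (1 * P.d)) / B1.aSeq 1 P.L 1 *
          (min (B1.aSeq 1 P.L 1 / (8 * P.d)) (1 / 2) *
              ∑ b : PBond P (0 + 1), ‖toC (h (cornerIter 1 b.src)) * (toC (h (cornerIter 1 b.tgt)))⁻¹ *
                (if b.tgt = (fun _ => 1) then (1 : ℂ) else 0) - (if b.src = (fun _ => 1) then (1 : ℂ) else 0)‖ ^ 2
            - B1.aSeq 1 P.L 1 ^ 2 * c₁ *
              ((⌊(((P.L : ℝ) ^ 1) - 1 + 3) / (1 : ℕ)⌋₊ + 3) ^ (0 + 1) * Real.exp (-(δ₀ * (((P.L : ℝ) ^ 1)⁻¹ * (2 * 0)))) +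
                Real.exp (-(δ₀ / 2 * (((P.L : ℝ) ^ 1)⁻¹ * 0)))) *
              ∑ y : Balaban1983to89.Site P (0 + 1), ‖(if y = (fun _ => 1) then (1 : ℂ) else 0)‖ ^ 2)
        ≤ (star (fun y : Balaban1983to89.Site P (0 + 1) => if y = (fun _ => 1) then (1 : ℂ) else 0) ⬝ᵥ
            (deltaLocT (B1RG242Torus.α P 1 1 * (P.L : ℝ) ^ (1 * P.d)) P.eps⁻¹ (gaugeAct h (1 : GaugeField P 0 U1)) 1
              (cubeFam hPd (P.L ^ 1) (fun _ => 0) (fun _ => 4) 1 4) (lamFam hPd (P.L ^ 1) (fun _ => 0) (fun _ => 4) 1)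
              (cutoff 0 3 (B5Ineq137Torus.T P 0)) *ᵥ
            fun y : Balaban1983to89.Site P (0 + 1) => if y = (fun _ => 1) then (1 : ℂ) else 0)).re := by
  obtain ⟨δ₀, c₁, hδ₀, hc₁, H⟩ := ineq238_flat_cwt_of_le 0 2 (by norm_num) one_pos
  refine ⟨δ₀, c₁, hδ₀, hc₁, fun P hPd hL hm hK h => ?_⟩
  have hs0 : P.sitesPerDir 0 = 162 := by simp [Params.sitesPerDir, hL, hm, hK]
  have hs1 : P.sitesPerDir (0 + 1) = 54 := by simp [Params.sitesPerDir, hL, hm, hK]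
  have hv : ∀ μ : Fin P.d, ((fun _ => 1 : Balaban1983to89.Site P (0 + 1)) μ).val = 1 := by
    intro μ
    show ZMod.val (1 : ZMod (P.sitesPerDir (0 + 1))) = 1
    rw [hs1]; decide
  refine H P hPd hL 1 le_rfl (by rw [hK]; decide) (fun _ => 0) (fun _ => 4) (fun _ => by norm_num)
    (fun _ => by rw [hs0, hL]; norm_num) (fun _ => by rw [hs0, hL]; norm_num) 1 4 le_rfl 0 3 0 le_rfl le_rfl (by norm_num) (by norm_num)
    (fun _ => by rw [hs0, hL]; norm_num) (by rw [hL]; norm_num) h (fun y => if y = (fun _ => 1) then (1 : ℂ) else 0)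
    fun y₁ hy₁ μ => ?_
  have hy : y₁ = fun _ => 1 := by
    by_contra hne; exact hy₁ (if_neg hne)
  subst hy
  rw [hv μ, hL]
  norm_num

end Instance

/-! ## §5 (v1.1) (2.39)/(2.40) and (4.9)_{j≥1} AT FLAT `u` FOR THE PRINTED DATA — p31's `eq240_deltaLocT_flat` / `Z49_deltaLocT_flat` BY NAME -/

section Eq240Cwt

open BIJ88Sect2Statements (Eq240)
open BIJ88Normalization46 (Z49)
open BIJ88Eq240FlatTorus (compress qSq op240 c240 realify eq240_deltaLocT_flat Z49_deltaLocT_flat)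
open BIJ88Cutoffs21 (cutoff_apply)

/-- **p31's row hypotheses (i)–(iii) and the multiplicity, on the block of every deep `k`-site, FOR THE PRINTED DATA** (gen 26's `rowHyp_i` /
`rowHyp_ii` / `rowHyp_iii` through `mem_and_depth_of_mem_blockK`, label set `activeLabels` with `card_activeLabels_le`, any `m ≥ (⌊(L^k − 1 + R₀)/s⌋ + 3)^{d+1}`): the shape consumed by p31's
`ineq238_flat_mult`, `eq240_deltaLocT_flat`, `Z49_deltaLocT_flat`. [cite: BalabanImbrieJaffe1988, (2.35) p.263] -/
theorem rowHyps_of_deep (hPd : P.d = d + 1) {k : ℕ} (hk : 0 + k ≤ P.m + P.K) {c M0 : Fin (d + 1) → ℕ} {s W : ℕ} (hn : 1 ≤ P.L ^ k)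
    (hs : 1 ≤ s) (hfit0 : ∀ i, c i * P.L ^ k + P.L ^ k * M0 i ≤ P.sitesPerDir 0) {R R₀ R₁ : ℝ} (hR : 0 ≤ R) (hR₁ : 0 ≤ R₁) (hR10 : R₁ < R₀)
    (hW : 2 * (s : ℝ) / 3 + R₀ / 2 + R ≤ W) (hgap : ∀ i, ((P.L ^ k * M0 i : ℕ) : ℝ) + R ≤ P.sitesPerDir 0) {m : ℕ}
    (hm : (⌊(((P.L : ℝ) ^ k) - 1 + R₀) / s⌋₊ + 3) ^ (d + 1) ≤ m) {y₁ : Balaban1983to89.Site P (0 + k)}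
    (hdeep : ∀ μ, (c (Fin.cast hPd μ) : ℝ) * P.L ^ k + R₀ ≤ (P.L : ℝ) ^ k * (y₁ μ).val ∧
      (P.L : ℝ) ^ k * (y₁ μ).val + P.L ^ k + R₀ ≤ (c (Fin.cast hPd μ) : ℝ) * P.L ^ k + (P.L : ℝ) ^ k * M0 (Fin.cast hPd μ)) :
    (∀ x ∈ blockK k y₁, ∀ y, cutoff R₁ R₀ (B5Ineq137Torus.T P 0) x y ≠ 0 → ∑ α, lamFam hPd (P.L ^ k) c M0 s α x y = 1) ∧
    (∀ x ∈ blockK k y₁, ∀ (α : ↥(labels (P.L ^ k) M0 s)) y,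
        cutoff R₁ R₀ (B5Ineq137Torus.T P 0) x y * lamFam hPd (P.L ^ k) c M0 s α x y ≠ 0 →
          x ∈ cubeFam hPd (P.L ^ k) c M0 s W α ∧ y ∈ cubeFam hPd (P.L ^ k) c M0 s W α ∧
            ∀ w ∈ cubeT hPd (P.L ^ k) c (fun i => P.L ^ k * M0 i), w ∉ cubeFam hPd (P.L ^ k) c M0 s W α →
              R ≤ B5Ineq137Torus.T P 0 x w ∧ R ≤ B5Ineq137Torus.T P 0 y w) ∧
    (∀ x ∈ blockK k y₁, ∀ y, B5Ineq137Torus.T P 0 x y ≤ R₁ → cutoff R₁ R₀ (B5Ineq137Torus.T P 0) x y = 1) ∧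
    ∃ S : Finset ↥(labels (P.L ^ k) M0 s), S.card ≤ m ∧
      ∀ x ∈ blockK k y₁, ∀ (α : ↥(labels (P.L ^ k) M0 s)) y,
        cutoff R₁ R₀ (B5Ineq137Torus.T P 0) x y * lamFam hPd (P.L ^ k) c M0 s α x y ≠ 0 → α ∈ S := by
  have hR₀ : 0 ≤ R₀ := hR₁.trans hR10.le
  have hζ0 := cutoff_eq_zero_of_le (P := P) hR10
  have hxdeep := fun x (hx : x ∈ blockK k y₁) => mem_and_depth_of_mem_blockK hPd hk hfit0 hR₀ hdeep hx
  refine ⟨fun x hx => rowHyp_i hPd hfit0 hζ0 (hxdeep x hx).1 (hxdeep x hx).2,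
    fun x hx => rowHyp_ii hPd hn hs hfit0 hR hgap hW hζ0 (hxdeep x hx).1 (hxdeep x hx).2, fun x _ => rowHyp_iii hR10 x,
    (activeLabels hPd (P.L ^ k) c s R₀ y₁).subtype fun α => α ∈ labels (P.L ^ k) M0 s, ?_, fun x hx α y hne => ?_⟩
  · have h1 : ((activeLabels hPd (P.L ^ k) c s R₀ y₁).subtype fun α => α ∈ labels (P.L ^ k) M0 s).card ≤
        (activeLabels hPd (P.L ^ k) c s R₀ y₁).card := by
      rw [Finset.card_subtype]; exact Finset.card_filter_le _ _
    have h2 := card_activeLabels_le (hPd := hPd) (c := c) hn hs hR₀ y₁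
    have e : (((P.L ^ k : ℕ) : ℕ) : ℝ) = (P.L : ℝ) ^ k := by push_cast; rfl
    rw [e] at h2
    exact h1.trans (h2.trans hm)
  · rw [Finset.mem_subtype]
    exact mem_activeLabels_of_ne_zero_of_deep hk hs hfit0 hζ0 hx (hxdeep x hx).2 hne

/-- **Bonds meeting a deep region lie in `Ω₀^{(k)*}`** when `L^k ≤ R₀` (§1's `mem_starB_innerK_of_deep` read on the indicator of `Λ`).
[cite: BalabanImbrieJaffe1988, (2.38) p.264] -/
theorem mem_starB_of_mem_of_deep (hPd : P.d = d + 1) {k : ℕ} (hk : 0 + k ≤ P.m + P.K) {c M0 : Fin (d + 1) → ℕ}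
    (hfit0 : ∀ i, c i * P.L ^ k + P.L ^ k * M0 i ≤ P.sitesPerDir 0) {R₀ : ℝ} (hLR : (P.L : ℝ) ^ k ≤ R₀)
    {Λ : Finset (Balaban1983to89.Site P (0 + k))}
    (hdeepΛ : ∀ y₁ ∈ Λ, ∀ μ, (c (Fin.cast hPd μ) : ℝ) * P.L ^ k + R₀ ≤ (P.L : ℝ) ^ k * (y₁ μ).val ∧
      (P.L : ℝ) ^ k * (y₁ μ).val + P.L ^ k + R₀ ≤ (c (Fin.cast hPd μ) : ℝ) * P.L ^ k + (P.L : ℝ) ^ k * M0 (Fin.cast hPd μ)) :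
    ∀ b : PBond P (0 + k), (b.src ∈ Λ ∨ b.tgt ∈ Λ) → b ∈ starB (innerK k (cubeT hPd (P.L ^ k) c fun i => P.L ^ k * M0 i)) := by
  intro b hb
  have H := mem_starB_innerK_of_deep hPd hk hfit0 hLR (φ := fun y => if y ∈ Λ then (1 : ℂ) else 0)
    (fun y hy => hdeepΛ y (by by_contra hh; exact hy (if_neg hh))) b
  refine H (hb.imp (fun h1 => ?_) (fun h1 => ?_))
  · show (if b.src ∈ Λ then (1 : ℂ) else 0) ≠ 0
    rw [if_pos h1]; exact one_ne_zero
  · show (if b.tgt ∈ Λ then (1 : ℂ) else 0) ≠ 0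
    rw [if_pos h1]; exact one_ne_zero

/-- **(2.39)/(2.40) AT EVERY PURE-GAUGE BACKGROUND `u = 1^h` FOR THE PRINTED LOCALIZATION DATA** — p02's `Eq240` INHABITED on `ℓ²(Λ)`
(p. 264: *"We define C^{(k)}_Λ(u) = [(Δ_{k,loc}(u) + aL^{−2}Q(u)^*Q(u))|_Λ]^{−1}. (2.40) This is of course a nonlocal operator, but by (2.38),
C^{(k)}_Λ(u)^{−1} is bounded below"*): THERE EXIST `δ₀, c₁ > 0` depending on `(d, ℓ, a)` only (p31's constants of `ineq238_flat_mult`) such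
that for every volume, every `1 ≤ k ≤ K` with `k + 1 ≤ m + K`, every no-wrap box `Ω₀` shorter than the torus with torus gap `≥ R`, cube
spacing `s ≥ 1`, half-width `W ≥ 2s/3 + R₀/2 + R`, radii `0 ≤ R`, `0 ≤ R₁ < R₀`, every pure gauge `h`, every `Λ ⊆ T^{(k)}` that is a union of
`L`-blocks of sites whose `k`-blocks lie in `Ω₀` with chart margin `R₀` and whose unit bonds lie in `Ω₀^{(k)*}`, every `κ = a′L′^{−2} ≥ 0`, IF
the (2.35)-error is below the flat Poincaré constant, `(A/a_k)a_k²c₁(m·e^{−2δ₀R/L^k} + e^{−(δ₀/2)R₁/L^k}) < c₀((A/a_k)min(a_k/(8d),½), κ)`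
(`m = (⌊(L^k − 1 + R₀)/s⌋ + 3)^{d+1}`), THEN `Eq240 a′ L′ (Δ_{k,loc}(1^h)|_Λ) (Q̃(u_k)|_Λ)^* (Q̃(u_k)|_Λ) [(Δ_{k,loc}(1^h) + κQ(u_k)^*Q(u_k))|_Λ]^{−1}`,
`u_k = 1^{h∘corner_k}`, with `Δ_{k,loc}(1^h)` built from the torus cubes, the weights of (2.27) and the cut-off of (2.29) — p31's
`eq240_deltaLocT_flat` BY NAME, its data hypotheses DISCHARGED by `rowHyps_of_deep`, `cubeFam_nested`, `sum_abs_lamT_le_one`,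
`cutoff_mem_unitInterval`. [cite: BalabanImbrieJaffe1988, (2.40) p.264] -/
theorem eq240_flat_cwt (d ℓ : ℕ) (hℓ : 1 ≤ ℓ) {a : ℝ} (ha : 0 < a) :
    ∃ δ₀ c₁ : ℝ, 0 < δ₀ ∧ 0 < c₁ ∧ ∀ (P : Params) (hPd : P.d = d + 1), P.L = ℓ + 1 →
      ∀ k : ℕ, 1 ≤ k → k ≤ P.K → k + 1 ≤ P.m + P.K → ∀ (c M0 : Fin (d + 1) → ℕ), (∀ i, 1 ≤ M0 i) →
        (∀ i, c i * P.L ^ k + P.L ^ k * M0 i ≤ P.sitesPerDir 0) → (∀ i, P.L ^ k * M0 i < P.sitesPerDir 0) →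
      ∀ (s W : ℕ), 1 ≤ s → ∀ (R R₀ R₁ : ℝ), 0 ≤ R → 0 ≤ R₁ → R₁ < R₀ → 2 * (s : ℝ) / 3 + R₀ / 2 + R ≤ W →
        (∀ i, ((P.L ^ k * M0 i : ℕ) : ℝ) + R ≤ P.sitesPerDir 0) →
      ∀ (h : GaugeTransf P 0 U1) (Λ : Finset (Balaban1983to89.Site P (0 + k))), IsBlockUnion 1 Λ →
        (∀ y₁ ∈ Λ, ∀ μ, (c (Fin.cast hPd μ) : ℝ) * P.L ^ k + R₀ ≤ (P.L : ℝ) ^ k * (y₁ μ).val ∧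
          (P.L : ℝ) ^ k * (y₁ μ).val + P.L ^ k + R₀ ≤ (c (Fin.cast hPd μ) : ℝ) * P.L ^ k + (P.L : ℝ) ^ k * M0 (Fin.cast hPd μ)) →
        (∀ b : PBond P (0 + k), (b.src ∈ Λ ∨ b.tgt ∈ Λ) → b ∈ starB (innerK k (cubeT hPd (P.L ^ k) c fun i => P.L ^ k * M0 i))) →
      ∀ (a' L' : ℝ), 0 ≤ a' * L' ^ (-(2 : ℤ)) →
        (B1RG242Torus.α P a k * (P.L : ℝ) ^ (k * P.d)) / B1.aSeq a P.L k *
            (B1.aSeq a P.L k ^ 2 * c₁ *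
              ((⌊(((P.L : ℝ) ^ k) - 1 + R₀) / s⌋₊ + 3) ^ (d + 1) * Real.exp (-(δ₀ * (((P.L : ℝ) ^ k)⁻¹ * (2 * R)))) +
                Real.exp (-(δ₀ / 2 * (((P.L : ℝ) ^ k)⁻¹ * R₁))))) <
          c240 P ((B1RG242Torus.α P a k * (P.L : ℝ) ^ (k * P.d)) / B1.aSeq a P.L k * min (B1.aSeq a P.L k / (8 * P.d)) (1 / 2))
            (a' * L' ^ (-(2 : ℤ))) →
        Eq240 a' L'
          (compress Λ (deltaLocT (B1RG242Torus.α P a k * (P.L : ℝ) ^ (k * P.d)) P.eps⁻¹ (gaugeAct h (1 : GaugeField P 0 U1)) k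
            (cubeFam hPd (P.L ^ k) c M0 s W) (lamFam hPd (P.L ^ k) c M0 s) (cutoff R₁ R₀ (B5Ineq137Torus.T P 0))))
          (compress Λ (qSq (gaugeAct (fun y => h (cornerIter k y)) (1 : GaugeField P (0 + k) U1)))ᴴ)
          (compress Λ (qSq (gaugeAct (fun y => h (cornerIter k y)) (1 : GaugeField P (0 + k) U1))))
          (compress Λ (op240 (deltaLocT (B1RG242Torus.α P a k * (P.L : ℝ) ^ (k * P.d)) P.eps⁻¹ (gaugeAct h (1 : GaugeField P 0 U1)) k
            (cubeFam hPd (P.L ^ k) c M0 s W) (lamFam hPd (P.L ^ k) c M0 s) (cutoff R₁ R₀ (B5Ineq137Torus.T P 0))) (a' * L' ^ (-(2 : ℤ)))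
            (gaugeAct (fun y => h (cornerIter k y)) (1 : GaugeField P (0 + k) U1))))⁻¹ := by
  obtain ⟨δ₀, c₁, hδ₀, hc₁, H⟩ := eq240_deltaLocT_flat d ℓ hℓ ha
  refine ⟨δ₀, c₁, hδ₀, hc₁, ?_⟩
  intro P hPd hPL k hk1 hkK hk' c M0 hM0 hfit0 hN0 s W hs R R₀ R₁ hR hR₁ hR10 hW hgap h Λ hΛ hdeepΛ hbonds a' L' hκ hsmall
  have hn : 1 ≤ P.L ^ k := Nat.one_le_pow _ _ P.L_pos
  have hk : 0 + k ≤ P.m + P.K := by omega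
  set mN : ℕ := (⌊(((P.L : ℝ) ^ k) - 1 + R₀) / s⌋₊ + 3) ^ (d + 1) with hmNdef
  have hmN : ((mN : ℕ) : ℝ) = (((⌊(((P.L : ℝ) ^ k) - 1 + R₀) / s⌋₊ : ℕ) : ℝ) + 3) ^ (d + 1) := by
    rw [hmNdef]; push_cast; ring
  rw [← hmN] at hsmall
  exact H P hPd hPL k hk1 hkK hk' c M0 hM0 hfit0 hN0 _ (cubeFam hPd (P.L ^ k) c M0 s W) (lamFam hPd (P.L ^ k) c M0 s)
    (cutoff R₁ R₀ (B5Ineq137Torus.T P 0)) (cubeFam_nested hM0) (sum_abs_lamT_le_one hfit0) (cutoff_mem_unitInterval R₁ R₀) h R R₁ hR hR₁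
    mN Λ hΛ (fun y₁ hy₁ => rowHyps_of_deep hPd hk hn hs hfit0 hR hR₁ hR10 hW hgap hmNdef.symm.le (hdeepΛ y₁ hy₁)) hbonds a' L' hκ hsmall

/-- **(4.9) AT A GENERAL STEP `j = k ≥ 1`, AT EVERY PURE-GAUGE BACKGROUND, FOR THE PRINTED LOCALIZATION DATA** — r18's `Z49_eq` with
`T.PosDef` DISCHARGED (p. 275: the Gaussian normalization `Z^{(j)}_{Λ₁₀^{(j)}}(u)` of (4.9), whose precision operator at `j ≥ 1` is
`Δ_{j,loc}(u) + aL^{−2}Q(u)^*Q(u)` restricted to `Λ₁₀^{(j)}` — r18's cell note *"j ≥ 1 needs the (2.38)/(2.40) positivity of Δ_{j,loc}"*):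
under the hypotheses of `eq240_flat_cwt` (no block-union hypothesis needed) and `κ ≥ 0`, the realified precision matrix
`T = realify((Δ_{k,loc}(1^h) + κQ(u_k)^*Q(u_k))|_Λ)` (two real coordinates per site) is positive definite and
`Z49 T E N = e^{−EN}√(2π)^{2|Λ|}/√det T` — p31's `Z49_deltaLocT_flat` BY NAME; the symmetry of the data (`λ_α(y,x) = λ_α(x,y)`,
`ζ″(y,x) = ζ″(x,y)`, making `Δ_{k,loc}` Hermitian) is gen 26's `lamT_comm` and `T_symm`. [cite: BalabanImbrieJaffe1988, (4.9) p.275] -/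
theorem Z49_flat_cwt (d ℓ : ℕ) (hℓ : 1 ≤ ℓ) {a : ℝ} (ha : 0 < a) :
    ∃ δ₀ c₁ : ℝ, 0 < δ₀ ∧ 0 < c₁ ∧ ∀ (P : Params) (hPd : P.d = d + 1), P.L = ℓ + 1 →
      ∀ k : ℕ, 1 ≤ k → k ≤ P.K → k + 1 ≤ P.m + P.K → ∀ (c M0 : Fin (d + 1) → ℕ), (∀ i, 1 ≤ M0 i) →
        (∀ i, c i * P.L ^ k + P.L ^ k * M0 i ≤ P.sitesPerDir 0) → (∀ i, P.L ^ k * M0 i < P.sitesPerDir 0) →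
      ∀ (s W : ℕ), 1 ≤ s → ∀ (R R₀ R₁ : ℝ), 0 ≤ R → 0 ≤ R₁ → R₁ < R₀ → 2 * (s : ℝ) / 3 + R₀ / 2 + R ≤ W →
        (∀ i, ((P.L ^ k * M0 i : ℕ) : ℝ) + R ≤ P.sitesPerDir 0) →
      ∀ (h : GaugeTransf P 0 U1) (Λ : Finset (Balaban1983to89.Site P (0 + k))),
        (∀ y₁ ∈ Λ, ∀ μ, (c (Fin.cast hPd μ) : ℝ) * P.L ^ k + R₀ ≤ (P.L : ℝ) ^ k * (y₁ μ).val ∧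
          (P.L : ℝ) ^ k * (y₁ μ).val + P.L ^ k + R₀ ≤ (c (Fin.cast hPd μ) : ℝ) * P.L ^ k + (P.L : ℝ) ^ k * M0 (Fin.cast hPd μ)) →
        (∀ b : PBond P (0 + k), (b.src ∈ Λ ∨ b.tgt ∈ Λ) → b ∈ starB (innerK k (cubeT hPd (P.L ^ k) c fun i => P.L ^ k * M0 i))) →
      ∀ (κ : ℝ), 0 ≤ κ →
        (B1RG242Torus.α P a k * (P.L : ℝ) ^ (k * P.d)) / B1.aSeq a P.L k *
            (B1.aSeq a P.L k ^ 2 * c₁ *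
              ((⌊(((P.L : ℝ) ^ k) - 1 + R₀) / s⌋₊ + 3) ^ (d + 1) * Real.exp (-(δ₀ * (((P.L : ℝ) ^ k)⁻¹ * (2 * R)))) +
                Real.exp (-(δ₀ / 2 * (((P.L : ℝ) ^ k)⁻¹ * R₁))))) <
          c240 P ((B1RG242Torus.α P a k * (P.L : ℝ) ^ (k * P.d)) / B1.aSeq a P.L k * min (B1.aSeq a P.L k / (8 * P.d)) (1 / 2)) κ →
      ∀ (Es N : ℝ),
        (realify (compress Λ (op240 (deltaLocT (B1RG242Torus.α P a k * (P.L : ℝ) ^ (k * P.d)) P.eps⁻¹ (gaugeAct h (1 : GaugeField P 0 U1)) k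
            (cubeFam hPd (P.L ^ k) c M0 s W) (lamFam hPd (P.L ^ k) c M0 s) (cutoff R₁ R₀ (B5Ineq137Torus.T P 0))) κ
            (gaugeAct (fun y => h (cornerIter k y)) (1 : GaugeField P (0 + k) U1))))).PosDef ∧
        Z49 (realify (compress Λ (op240 (deltaLocT (B1RG242Torus.α P a k * (P.L : ℝ) ^ (k * P.d)) P.eps⁻¹ (gaugeAct h (1 : GaugeField P 0 U1)) k
            (cubeFam hPd (P.L ^ k) c M0 s W) (lamFam hPd (P.L ^ k) c M0 s) (cutoff R₁ R₀ (B5Ineq137Torus.T P 0))) κ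
            (gaugeAct (fun y => h (cornerIter k y)) (1 : GaugeField P (0 + k) U1))))) Es N =
          Real.exp (-(Es * N)) * (Real.sqrt (2 * Real.pi) ^ Fintype.card (↥Λ × Fin 2) /
            Real.sqrt (realify (compress Λ (op240 (deltaLocT (B1RG242Torus.α P a k * (P.L : ℝ) ^ (k * P.d)) P.eps⁻¹
              (gaugeAct h (1 : GaugeField P 0 U1)) k (cubeFam hPd (P.L ^ k) c M0 s W) (lamFam hPd (P.L ^ k) c M0 s)
              (cutoff R₁ R₀ (B5Ineq137Torus.T P 0))) κ (gaugeAct (fun y => h (cornerIter k y)) (1 : GaugeField P (0 + k) U1))))).det) := by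
  obtain ⟨δ₀, c₁, hδ₀, hc₁, H⟩ := Z49_deltaLocT_flat d ℓ hℓ ha
  refine ⟨δ₀, c₁, hδ₀, hc₁, ?_⟩
  intro P hPd hPL k hk1 hkK hk' c M0 hM0 hfit0 hN0 s W hs R R₀ R₁ hR hR₁ hR10 hW hgap h Λ hdeepΛ hbonds κ hκ hsmall Es N
  have hn : 1 ≤ P.L ^ k := Nat.one_le_pow _ _ P.L_pos
  have hk : 0 + k ≤ P.m + P.K := by omega
  set mN : ℕ := (⌊(((P.L : ℝ) ^ k) - 1 + R₀) / s⌋₊ + 3) ^ (d + 1) with hmNdef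
  have hmN : ((mN : ℕ) : ℝ) = (((⌊(((P.L : ℝ) ^ k) - 1 + R₀) / s⌋₊ : ℕ) : ℝ) + 3) ^ (d + 1) := by
    rw [hmNdef]; push_cast; ring
  rw [← hmN] at hsmall
  have hlamS : ∀ (α : ↥(labels (P.L ^ k) M0 s)) (x y : Balaban1983to89.Site P 0),
      lamFam hPd (P.L ^ k) c M0 s α y x = lamFam hPd (P.L ^ k) c M0 s α x y :=
    fun α x y => (lamT_comm (hPd := hPd) (n := P.L ^ k) (c := c) (M0 := M0) (s := s) α.1 x y).symm
  have hζS : ∀ x y : Balaban1983to89.Site P 0, cutoff R₁ R₀ (B5Ineq137Torus.T P 0) y x = cutoff R₁ R₀ (B5Ineq137Torus.T P 0) x y :=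
    fun x y => by rw [cutoff_apply, cutoff_apply, B5Ineq137Torus.T_symm]
  exact H P hPd hPL k hk1 hkK hk' c M0 hM0 hfit0 hN0 _ (cubeFam hPd (P.L ^ k) c M0 s W) (lamFam hPd (P.L ^ k) c M0 s)
    (cutoff R₁ R₀ (B5Ineq137Torus.T P 0)) (cubeFam_nested hM0) (sum_abs_lamT_le_one hfit0) (cutoff_mem_unitInterval R₁ R₀) hlamS hζS h R R₁
    hR hR₁ mN Λ (fun y₁ hy₁ => rowHyps_of_deep hPd hk hn hs hfit0 hR hR₁ hR10 hW hgap hmNdef.symm.le (hdeepΛ y₁ hy₁)) hbonds κ hκ hsmall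
    Es N

/-- **(4.9)_{j = k ≥ 1} AT FLAT `u` FOR THE PRINTED DATA, ONE SUPPORT HYPOTHESIS**: as `Z49_flat_cwt` with the bond hypothesis replaced by
`L^k ≤ R₀` (`mem_starB_of_mem_of_deep`). [cite: BalabanImbrieJaffe1988, (4.9) p.275] -/
theorem Z49_flat_cwt_of_le (d ℓ : ℕ) (hℓ : 1 ≤ ℓ) {a : ℝ} (ha : 0 < a) :
    ∃ δ₀ c₁ : ℝ, 0 < δ₀ ∧ 0 < c₁ ∧ ∀ (P : Params) (hPd : P.d = d + 1), P.L = ℓ + 1 →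
      ∀ k : ℕ, 1 ≤ k → k ≤ P.K → k + 1 ≤ P.m + P.K → ∀ (c M0 : Fin (d + 1) → ℕ), (∀ i, 1 ≤ M0 i) →
        (∀ i, c i * P.L ^ k + P.L ^ k * M0 i ≤ P.sitesPerDir 0) → (∀ i, P.L ^ k * M0 i < P.sitesPerDir 0) →
      ∀ (s W : ℕ), 1 ≤ s → ∀ (R R₀ R₁ : ℝ), 0 ≤ R → 0 ≤ R₁ → R₁ < R₀ → 2 * (s : ℝ) / 3 + R₀ / 2 + R ≤ W →
        (∀ i, ((P.L ^ k * M0 i : ℕ) : ℝ) + R ≤ P.sitesPerDir 0) → (P.L : ℝ) ^ k ≤ R₀ →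
      ∀ (h : GaugeTransf P 0 U1) (Λ : Finset (Balaban1983to89.Site P (0 + k))),
        (∀ y₁ ∈ Λ, ∀ μ, (c (Fin.cast hPd μ) : ℝ) * P.L ^ k + R₀ ≤ (P.L : ℝ) ^ k * (y₁ μ).val ∧
          (P.L : ℝ) ^ k * (y₁ μ).val + P.L ^ k + R₀ ≤ (c (Fin.cast hPd μ) : ℝ) * P.L ^ k + (P.L : ℝ) ^ k * M0 (Fin.cast hPd μ)) →
      ∀ (κ : ℝ), 0 ≤ κ →
        (B1RG242Torus.α P a k * (P.L : ℝ) ^ (k * P.d)) / B1.aSeq a P.L k *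
            (B1.aSeq a P.L k ^ 2 * c₁ *
              ((⌊(((P.L : ℝ) ^ k) - 1 + R₀) / s⌋₊ + 3) ^ (d + 1) * Real.exp (-(δ₀ * (((P.L : ℝ) ^ k)⁻¹ * (2 * R)))) +
                Real.exp (-(δ₀ / 2 * (((P.L : ℝ) ^ k)⁻¹ * R₁))))) <
          c240 P ((B1RG242Torus.α P a k * (P.L : ℝ) ^ (k * P.d)) / B1.aSeq a P.L k * min (B1.aSeq a P.L k / (8 * P.d)) (1 / 2)) κ →
      ∀ (Es N : ℝ),
        (realify (compress Λ (op240 (deltaLocT (B1RG242Torus.α P a k * (P.L : ℝ) ^ (k * P.d)) P.eps⁻¹ (gaugeAct h (1 : GaugeField P 0 U1)) k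
            (cubeFam hPd (P.L ^ k) c M0 s W) (lamFam hPd (P.L ^ k) c M0 s) (cutoff R₁ R₀ (B5Ineq137Torus.T P 0))) κ
            (gaugeAct (fun y => h (cornerIter k y)) (1 : GaugeField P (0 + k) U1))))).PosDef ∧
        Z49 (realify (compress Λ (op240 (deltaLocT (B1RG242Torus.α P a k * (P.L : ℝ) ^ (k * P.d)) P.eps⁻¹ (gaugeAct h (1 : GaugeField P 0 U1)) k
            (cubeFam hPd (P.L ^ k) c M0 s W) (lamFam hPd (P.L ^ k) c M0 s) (cutoff R₁ R₀ (B5Ineq137Torus.T P 0))) κ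
            (gaugeAct (fun y => h (cornerIter k y)) (1 : GaugeField P (0 + k) U1))))) Es N =
          Real.exp (-(Es * N)) * (Real.sqrt (2 * Real.pi) ^ Fintype.card (↥Λ × Fin 2) /
            Real.sqrt (realify (compress Λ (op240 (deltaLocT (B1RG242Torus.α P a k * (P.L : ℝ) ^ (k * P.d)) P.eps⁻¹
              (gaugeAct h (1 : GaugeField P 0 U1)) k (cubeFam hPd (P.L ^ k) c M0 s W) (lamFam hPd (P.L ^ k) c M0 s)
              (cutoff R₁ R₀ (B5Ineq137Torus.T P 0))) κ (gaugeAct (fun y => h (cornerIter k y)) (1 : GaugeField P (0 + k) U1))))).det) := by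
  obtain ⟨δ₀, c₁, hδ₀, hc₁, H⟩ := Z49_flat_cwt d ℓ hℓ ha
  refine ⟨δ₀, c₁, hδ₀, hc₁, ?_⟩
  intro P hPd hPL k hk1 hkK hk' c M0 hM0 hfit0 hN0 s W hs R R₀ R₁ hR hR₁ hR10 hW hgap hLR h Λ hdeepΛ
  have hk : 0 + k ≤ P.m + P.K := by omega
  exact H P hPd hPL k hk1 hkK hk' c M0 hM0 hfit0 hN0 s W hs R R₀ R₁ hR hR₁ hR10 hW hgap h Λ hdeepΛ
    (mem_starB_of_mem_of_deep hPd hk hfit0 hLR hdeepΛ)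

end Eq240Cwt

/-! ## §6 (v1.2) (2.41) AT FLAT `u` FOR THE PRINTED DATA — p31's `decay241_deltaLocT_flat` BY NAME -/

section Decay241Cwt

open BIJ88Eq240FlatTorus (compress op240 c240)
open BIJ88Decay241FlatTorus (decay241_deltaLocT_flat)

/-- **(2.41) AT EVERY FLAT / PURE-GAUGE BACKGROUND `u = 1^h` FOR THE PRINTED LOCALIZATION DATA** (p. 264: *"by (2.38), C^{(k)}_Λ(u)^{−1} is
bounded below and a random walk expansion as in [6] can be used to prove that |C^{(k)}_Λ(u; x₁, x₂)| ≦ ce^{−c|x₁−x₂|}. (2.41)"*): for every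
`(d, ℓ, a)`, every multiplicity bound `m` and `Q^*Q`-coefficient `κ̂ > 0` THERE EXIST `δ₀, c₁, δ₁, c₂ > 0` such that for every volume, every
`1 ≤ k ≤ K` with `k + 1 ≤ m + K`, every no-wrap box `Ω₀` shorter than the torus with torus gap `≥ R`, cube spacing `s ≥ 1` with
`(⌊(L^k − 1 + R₀)/s⌋ + 3)^{d+1} ≤ m` (e.g. `m = 3^{d+1}` for `s ≥ L^k + R₀`), half-width `W ≥ 2s/3 + R₀/2 + R`, radii `0 ≤ R`, `0 ≤ R₁ < R₀`, every
pure gauge `h`, every `Λ ⊆ T^{(k)}` a union of `L`-blocks of sites whose `k`-blocks lie in `Ω₀` with chart margin `R₀` and whose unit bonds lie in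
`Ω₀^{(k)*}`, IF the (2.35)-error is at most half the flat Poincaré constant,
`(A/a_k)a_k²c₁(m·e^{−2δ₀R/L^k} + e^{−(δ₀/2)R₁/L^k}) ≤ ½c₀((A/a_k)min(a_k/(8d),½), (A/a_k)κ̂)`, THEN
`‖[(Δ_{k,loc}(1^h) + (A/a_k)κ̂Q(u_k)^*Q(u_k))|_Λ]^{−1}(x₁, x₂)‖ ≤ (a_k/A)·c₂·e^{−δ₁|x₁−x₂|_{T^{(k)}}}` for all `x₁, x₂ ∈ Λ`, with `Δ_{k,loc}(1^h)` built
from the torus cubes, the weights of (2.27) and the cut-off of (2.29) — p31's `decay241_deltaLocT_flat` BY NAME (its engine: the finite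
Combes–Thomas bound of [6] Sect. 5 as proved in the tree), data hypotheses DISCHARGED by §5's `rowHyps_of_deep` and gen 26.
[cite: BalabanImbrieJaffe1988, (2.41) p.264] -/
theorem decay241_flat_cwt (d ℓ : ℕ) (hℓ : 1 ≤ ℓ) {a : ℝ} (ha : 0 < a) (m : ℕ) {κ' : ℝ} (hκ' : 0 < κ') :
    ∃ δ₀ c₁ δ₁ c₂ : ℝ, 0 < δ₀ ∧ 0 < c₁ ∧ 0 < δ₁ ∧ 0 < c₂ ∧ ∀ (P : Params) (hPd : P.d = d + 1), P.L = ℓ + 1 →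
      ∀ k : ℕ, 1 ≤ k → k ≤ P.K → k + 1 ≤ P.m + P.K → ∀ (c M0 : Fin (d + 1) → ℕ), (∀ i, 1 ≤ M0 i) →
        (∀ i, c i * P.L ^ k + P.L ^ k * M0 i ≤ P.sitesPerDir 0) → (∀ i, P.L ^ k * M0 i < P.sitesPerDir 0) →
      ∀ (s W : ℕ), 1 ≤ s → ∀ (R R₀ R₁ : ℝ), 0 ≤ R → 0 ≤ R₁ → R₁ < R₀ → 2 * (s : ℝ) / 3 + R₀ / 2 + R ≤ W →
        (∀ i, ((P.L ^ k * M0 i : ℕ) : ℝ) + R ≤ P.sitesPerDir 0) → (⌊(((P.L : ℝ) ^ k) - 1 + R₀) / s⌋₊ + 3) ^ (d + 1) ≤ m →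
      ∀ (h : GaugeTransf P 0 U1) (Λ : Finset (Balaban1983to89.Site P (0 + k))), IsBlockUnion 1 Λ →
        (∀ y₁ ∈ Λ, ∀ μ, (c (Fin.cast hPd μ) : ℝ) * P.L ^ k + R₀ ≤ (P.L : ℝ) ^ k * (y₁ μ).val ∧
          (P.L : ℝ) ^ k * (y₁ μ).val + P.L ^ k + R₀ ≤ (c (Fin.cast hPd μ) : ℝ) * P.L ^ k + (P.L : ℝ) ^ k * M0 (Fin.cast hPd μ)) →
        (∀ b : PBond P (0 + k), (b.src ∈ Λ ∨ b.tgt ∈ Λ) → b ∈ starB (innerK k (cubeT hPd (P.L ^ k) c fun i => P.L ^ k * M0 i))) →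
        (B1RG242Torus.α P a k * (P.L : ℝ) ^ (k * P.d)) / B1.aSeq a P.L k *
            (B1.aSeq a P.L k ^ 2 * c₁ *
              ((m : ℝ) * Real.exp (-(δ₀ * (((P.L : ℝ) ^ k)⁻¹ * (2 * R)))) + Real.exp (-(δ₀ / 2 * (((P.L : ℝ) ^ k)⁻¹ * R₁))))) ≤
          1 / 2 * c240 P ((B1RG242Torus.α P a k * (P.L : ℝ) ^ (k * P.d)) / B1.aSeq a P.L k * min (B1.aSeq a P.L k / (8 * P.d)) (1 / 2))
            ((B1RG242Torus.α P a k * (P.L : ℝ) ^ (k * P.d)) / B1.aSeq a P.L k * κ') →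
      ∀ x₁ x₂ : ↥Λ,
        ‖(compress Λ (op240 (deltaLocT (B1RG242Torus.α P a k * (P.L : ℝ) ^ (k * P.d)) P.eps⁻¹ (gaugeAct h (1 : GaugeField P 0 U1)) k
            (cubeFam hPd (P.L ^ k) c M0 s W) (lamFam hPd (P.L ^ k) c M0 s) (cutoff R₁ R₀ (B5Ineq137Torus.T P 0)))
            ((B1RG242Torus.α P a k * (P.L : ℝ) ^ (k * P.d)) / B1.aSeq a P.L k * κ')
            (gaugeAct (fun y => h (cornerIter k y)) (1 : GaugeField P (0 + k) U1))))⁻¹ x₁ x₂‖ ≤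
          ((B1RG242Torus.α P a k * (P.L : ℝ) ^ (k * P.d)) / B1.aSeq a P.L k)⁻¹ * c₂ *
            Real.exp (-(δ₁ * B5Ineq137Torus.T P (0 + k) x₁ x₂)) := by
  obtain ⟨δ₀, c₁, δ₁, c₂, hδ₀, hc₁, hδ₁, hc₂, H⟩ := decay241_deltaLocT_flat d ℓ hℓ ha m hκ'
  refine ⟨δ₀, c₁, δ₁, c₂, hδ₀, hc₁, hδ₁, hc₂, ?_⟩
  intro P hPd hPL k hk1 hkK hk' c M0 hM0 hfit0 hN0 s W hs R R₀ R₁ hR hR₁ hR10 hW hgap hm h Λ hΛ hdeepΛ hbonds hsmall x₁ x₂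
  have hn : 1 ≤ P.L ^ k := Nat.one_le_pow _ _ P.L_pos
  have hk : 0 + k ≤ P.m + P.K := by omega
  exact H P hPd hPL k hk1 hkK hk' c M0 hM0 hfit0 hN0 _ (cubeFam hPd (P.L ^ k) c M0 s W) (lamFam hPd (P.L ^ k) c M0 s)
    (cutoff R₁ R₀ (B5Ineq137Torus.T P 0)) (cubeFam_nested hM0) (sum_abs_lamT_le_one hfit0) (cutoff_mem_unitInterval R₁ R₀) h R R₁ hR hR₁ Λ hΛ
    (fun y₁ hy₁ => rowHyps_of_deep hPd hk hn hs hfit0 hR hR₁ hR10 hW hgap hm (hdeepΛ y₁ hy₁)) hbonds hsmall x₁ x₂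

/-- **(2.41) AT FLAT `u` FOR THE PRINTED DATA WITH THE VOLUME-FREE MULTIPLICITY `3^{d+1}` AND ONE SUPPORT HYPOTHESIS**: as `decay241_flat_cwt`
with `m = 3^{d+1}` for cube spacings `s ≥ L^k + R₀` (gen 26's `card_activeLabels_le_three_pow` regime) and the bond hypothesis replaced by
`L^k ≤ R₀` (§5's `mem_starB_of_mem_of_deep`) — constants depending on `(d, ℓ, a, κ̂)` only. [cite: BalabanImbrieJaffe1988, (2.41) p.264] -/
theorem decay241_flat_cwt_three_pow (d ℓ : ℕ) (hℓ : 1 ≤ ℓ) {a : ℝ} (ha : 0 < a) {κ' : ℝ} (hκ' : 0 < κ') :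
    ∃ δ₀ c₁ δ₁ c₂ : ℝ, 0 < δ₀ ∧ 0 < c₁ ∧ 0 < δ₁ ∧ 0 < c₂ ∧ ∀ (P : Params) (hPd : P.d = d + 1), P.L = ℓ + 1 →
      ∀ k : ℕ, 1 ≤ k → k ≤ P.K → k + 1 ≤ P.m + P.K → ∀ (c M0 : Fin (d + 1) → ℕ), (∀ i, 1 ≤ M0 i) →
        (∀ i, c i * P.L ^ k + P.L ^ k * M0 i ≤ P.sitesPerDir 0) → (∀ i, P.L ^ k * M0 i < P.sitesPerDir 0) →
      ∀ (s W : ℕ), 1 ≤ s → ∀ (R R₀ R₁ : ℝ), 0 ≤ R → 0 ≤ R₁ → R₁ < R₀ → 2 * (s : ℝ) / 3 + R₀ / 2 + R ≤ W →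
        (∀ i, ((P.L ^ k * M0 i : ℕ) : ℝ) + R ≤ P.sitesPerDir 0) → (P.L : ℝ) ^ k ≤ R₀ → (P.L : ℝ) ^ k + R₀ ≤ s →
      ∀ (h : GaugeTransf P 0 U1) (Λ : Finset (Balaban1983to89.Site P (0 + k))), IsBlockUnion 1 Λ →
        (∀ y₁ ∈ Λ, ∀ μ, (c (Fin.cast hPd μ) : ℝ) * P.L ^ k + R₀ ≤ (P.L : ℝ) ^ k * (y₁ μ).val ∧
          (P.L : ℝ) ^ k * (y₁ μ).val + P.L ^ k + R₀ ≤ (c (Fin.cast hPd μ) : ℝ) * P.L ^ k + (P.L : ℝ) ^ k * M0 (Fin.cast hPd μ)) →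
        (B1RG242Torus.α P a k * (P.L : ℝ) ^ (k * P.d)) / B1.aSeq a P.L k *
            (B1.aSeq a P.L k ^ 2 * c₁ *
              ((3 : ℝ) ^ (d + 1) * Real.exp (-(δ₀ * (((P.L : ℝ) ^ k)⁻¹ * (2 * R)))) + Real.exp (-(δ₀ / 2 * (((P.L : ℝ) ^ k)⁻¹ * R₁))))) ≤
          1 / 2 * c240 P ((B1RG242Torus.α P a k * (P.L : ℝ) ^ (k * P.d)) / B1.aSeq a P.L k * min (B1.aSeq a P.L k / (8 * P.d)) (1 / 2))
            ((B1RG242Torus.α P a k * (P.L : ℝ) ^ (k * P.d)) / B1.aSeq a P.L k * κ') →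
      ∀ x₁ x₂ : ↥Λ,
        ‖(compress Λ (op240 (deltaLocT (B1RG242Torus.α P a k * (P.L : ℝ) ^ (k * P.d)) P.eps⁻¹ (gaugeAct h (1 : GaugeField P 0 U1)) k
            (cubeFam hPd (P.L ^ k) c M0 s W) (lamFam hPd (P.L ^ k) c M0 s) (cutoff R₁ R₀ (B5Ineq137Torus.T P 0)))
            ((B1RG242Torus.α P a k * (P.L : ℝ) ^ (k * P.d)) / B1.aSeq a P.L k * κ')
            (gaugeAct (fun y => h (cornerIter k y)) (1 : GaugeField P (0 + k) U1))))⁻¹ x₁ x₂‖ ≤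
          ((B1RG242Torus.α P a k * (P.L : ℝ) ^ (k * P.d)) / B1.aSeq a P.L k)⁻¹ * c₂ *
            Real.exp (-(δ₁ * B5Ineq137Torus.T P (0 + k) x₁ x₂)) := by
  obtain ⟨δ₀, c₁, δ₁, c₂, hδ₀, hc₁, hδ₁, hc₂, H⟩ := decay241_flat_cwt d ℓ hℓ ha (3 ^ (d + 1)) hκ'
  refine ⟨δ₀, c₁, δ₁, c₂, hδ₀, hc₁, hδ₁, hc₂, ?_⟩
  intro P hPd hPL k hk1 hkK hk' c M0 hM0 hfit0 hN0 s W hs R R₀ R₁ hR hR₁ hR10 hW hgap hLR hbig h Λ hΛ hdeepΛ hsmall x₁ x₂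
  have hk : 0 + k ≤ P.m + P.K := by omega
  have hs0 : (0 : ℝ) < s := by exact_mod_cast hs
  -- the multiplicity: `⌊(L^k − 1 + R₀)/s⌋ = 0` for `s ≥ L^k + R₀`
  have hfloor : ⌊(((P.L : ℝ) ^ k) - 1 + R₀) / s⌋₊ = 0 := by
    rw [Nat.floor_eq_zero, div_lt_one hs0]; linarith
  have hm : (⌊(((P.L : ℝ) ^ k) - 1 + R₀) / s⌋₊ + 3) ^ (d + 1) ≤ 3 ^ (d + 1) := by rw [hfloor]
  have hsmall' := hsmall
  rw [show ((3 : ℝ) ^ (d + 1)) = ((3 ^ (d + 1) : ℕ) : ℝ) by push_cast; rfl] at hsmall'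
  exact H P hPd hPL k hk1 hkK hk' c M0 hM0 hfit0 hN0 s W hs R R₀ R₁ hR hR₁ hR10 hW hgap hm h Λ hΛ hdeepΛ
    (mem_starB_of_mem_of_deep hPd hk hfit0 hLR hdeepΛ) hsmall' x₁ x₂

end Decay241Cwt

end

end Literature.MathematicalPhysics.QuantumFieldTheory.BalabanImbrieJaffe1984to88.BIJ88Ineq238FlatCwtTorus
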